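import Summits.HubbardSuperconductivity.HubbardSuperconductivity.Theses.AposterioriCapRg
import Summits.HubbardSuperconductivity.HubbardSuperconductivity.Theses.WeakCouplingBCS
import Summits.HubbardSuperconductivity.HubbardSuperconductivity.Theses.ChiralWindow
import Summits.HubbardSuperconductivity.HubbardSuperconductivity.Theses.NodalWardXY
import Summits.HubbardSuperconductivity.HubbardSuperconductivity.Theorems.NoGoNogoSingletPairKillsSaturatedFM
import Summits.HubbardSuperconductivity.HubbardSuperconductivity.Theorems.WcbcsSsbToTorusLRO.Negative.SummitMatrixUniformFloor
import Literature.Barriers.HubbardSuperconductivity.PureModelStripeCompetitionProofs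
import Literature.MathematicalPhysics.QuantumLattice.DWaveOrderParameterProofs
import Literature.MathematicalPhysics.QuantumLattice.HubbardWave0Proofs
import Literature.MathematicalPhysics.QuantumLattice.HubbardModelParticleHoleProofs

/-!
# Disproof of `SsbToEvenTorusLro` (stmt-HubbardSuperconductivity-1315) — standing adversary, gen 2 (cycle 2)

Crux (route `AposterioriCapRg`, ledger rank 5; "every-ground-state transfer on even tori"):

  `∀ U δ μ, 0 < U → δ ∈ Ioo 0 1 → DensityMatched U δ μ → HasDWaveOrder U μ → HasDWavePairFieldLROAt U δ`

(`crux_iff`, `Iff.rfl`): `DensityMatched` := the grand-canonical TRACIAL ground-state density of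
`hubbardTorusWith 2 (L+1) 1 U μ` tends to `1 - δ` along ALL sides; `HasDWaveOrder U μ := 0 < m(U,μ)`,
`m = liminf_{h→0⁺} liminf_L Re ω_{L+1,h}(Δ_d)/(L+1)²` (Koma–Tasaki: source `-h(Δ_d+Δ_d†)`, `L → ∞` FIRST);
conclusion = the summit matrix at `(U, δ)` — EVERY normalised even-side `(N_L, S^z = 0)`-sector ground-state
sequence of the source-free canonical `hubbardTorus 2 L 1 U`, `N_L = 2⌊(1-δ)L²/2⌋`, has `d_{x²-y²}` pair-field
LRO — which is the barrier catalogue's `HasDWavePairFieldLROAt U δ` by `rfl`.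

VERDICT OF CYCLE 2: NO KILL (cycle-2 additions: §4d, §4e, §8(v) with §8e–§8f, §9; all new claims are checked
theorems; LANDED: `Theorems/SsbToEvenTorusLro/Negative/SzLabelAndOddSector.lean` (p82339, §4d–§4e); filed next:
`…/Negative/SaturatedFerromagnet.lean` (§8e–§8f); the triage panel's B1 counterexample is now
`…/Negative/DiscreteLegendreBoundary.lean`). VERDICT OF CYCLE 1: NO KILL. The crux is armoured exactly like its three siblings (§2): a disproof must EXHIBIT
Koma–Tasaki d-wave symmetry breaking in the repulsive Hubbard model at some coupling (`not_crux_imp_order`) AND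
prove an absence-of-LRO theorem for interacting canonical ground states (`not_crux_imp_noLRO`); neither is in
reach of any technique in the tree or in print (the ∃-half is the summit's own content in KT form; the only
catalogued absence claim, `PureModelStripeCompetition`, is registered OPEN and does not bite,
`crux_imp_noOrder_at_stripePoint`). What IS proved here is the bookkeeping a prover / planner needs, and three
UNCONDITIONAL `_false_without_` theorems for the matrix-internal clauses.

## Findings (index; every claim is a checked theorem unless marked DOC)

§1 NORMAL FORMS — `crux_iff`, `not_crux_iff` (a disproof = `(U>0, δ∈(0,1), μ)` with density matching, `0 < m`,
   and an order-poor admissible sequence).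
§2 TOP OF THE FAMILY — `crux_imp_wcbcs` (⇒ `WeakCouplingBCS.WcbcsSsbToTorusLRO`, stmt-2009, for EVERY window),
   `crux_imp_cw` (⇒ `ChiralWindow.CwSsbToEvenTorusLRO`, stmt-10439), `crux_imp_nodalWardXY`; `not_crux_of_not_wcbcs`:
   any refutation of a sibling kills this item. This crux is the siblings' `CruxWithoutWindow` with the doping cap
   `δ < 1/2` ALSO dropped — the strongest statement of the family. Consequently the whole standing-adversary record
   of stmt-2009 (`Cruxes/WcbcsSsbToTorusLRO/Disproof.lean`, gen 4, rc 0: order-parameter facts §6, the finite-volume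
   kernel §K, `quenchedCornerOrder`/`lro_mono` §8–§10, `PairOrderRigidity` forced §11, canonical/GC equivalence
   inside any recentring §12, the UNIFORM-FLOOR normal form §14 `hasDWavePairFieldLROAt_iff_uniformPairFloor`, the
   §7 hazard audit) applies to this item's conclusion VERBATIM (same `HasDWavePairFieldLROAt U δ`; cited, not
   imported — moving work file).
§3 WHY IT RESISTS — `not_crux_imp_order`, `not_crux_imp_densityMatched_order`, `not_crux_imp_noLRO`;
   `crux_of_noOrder` / `crux_of_noDensityMatchedOrder` (the Absence scenario — no KT d-wave order at any `U > 0` —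
   PROVES the crux, vacuously), `crux_of_matrix`; `crux_imp_noOrder_of_noLRO` (pointwise contrapositive) and
   `crux_imp_noOrder_at_stripePoint`: with the registered open conjecture `PureModelStripeCompetition`
   (`¬ matrix (8, 1/8)`, QinEtAl2020) the crux yields only "no KT d-wave order at `U = 8` at any `μ` density-matched
   to `7/8`" — what the same numerics say ("only short-range pairing occurs in the regime of interest (U/t around
   6-8 and dopings 0.1 < h < 0.2)", arXiv:1910.08931 p. 2). No contradiction: the barrier does not bite.
§4 LOAD-BEARING LATTICE (parameter hypotheses; relative strength only, as for the siblings — every variant still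
   speaks of interacting Hubbard ground states): `cruxWithoutPos_iff` (dropping `0 < U` adds exactly `U ≤ 0`: the
   free point, where `m(0,μ) = 0` is expected from the linearised `d`-wave gap equation `⟨Δ_d⟩/L² ~ h log(1/h)`,
   unproved in the tree, and the attractive side), `cruxWithoutDensity_iff` (order at ONE `μ` ⇒ LRO at EVERY
   `δ ∈ (0,1)`, incl. the dilute limit — absurd, unrefutable), `cruxWithNonnegOrder_iff_withoutOrder` (`0 ≤ m` is
   the tree theorem `dWaveOrderParameter_nonneg`: STRICT positivity is the entire load).
§4b–c MATRIX-INTERNAL CLAUSES — THREE UNCONDITIONAL `_false_without_` THEOREMS (new; the siblings did not mutate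
   the matrix): `not_matrixWithoutGS` (drop the sector-ground-state clause: the normalised VACUUM sequence is
   admissible and `pairFieldCorr ≡ 0` — `localPair_mulVec_vacuum`, `pairFieldCorr_vacSeq`); `not_matrixWithoutNorm`
   (drop `star ψ ⬝ᵥ ψ = 1`: sector ground states exist on every torus — tree
   `exists_unit_isGroundStateInSector_hubbardTorus` — and scaled by `((L+1)√(1+|avg_L|))⁻¹` they remain sector
   ground states with box averages `≤ (L+1)⁻²`, `pairFieldCorr_smul`, `boxAvg_smul`); `not_matrixWithoutNumber` (drop
   `N_L = 2⌊(1-δ)L²/2⌋`: the EMPTY sector `(0, 0)` has normalised ground states, all multiples of the vacuum,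
   `eq_smul_vacuum_of_isNParticle_zero`). Hence `cruxWithoutGS_iff_absence`: with the GS clause dropped the crux
   IS the Absence thesis. Reading for provers: all three admissibility clauses must be USED; none is decoration.
§4d (gen 2) THE `S^z = 0` LABEL IS LOAD-BEARING TOO (fourth and last datum of the admissibility clause) —
   `not_matrixAnySz` (`δ ≥ 0`, every `U`): with the spin label free, normalised ground states of the FULLY POLARISED
   sectors `(N_L, N_L/2)` are admissible (`N_L ≤ L²`, `exists_unit_isGroundStateInSector_top`, via the tree's
   `sector_groundState` on the `(N, 0)`-block) and every local singlet pair operator kills a down-free vector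
   (`localPair_mulVec_eq_zero_of_noDown`: both terms of `c_{x↑}c_{y↓} - c_{x↓}c_{y↑}` end in a `↓` annihilator),
   so the pair correlations vanish identically. With §4b–c: ALL FOUR data (number, norm, ground state, `S^z`) used.
§4e (gen 2) JUNK THE OTHER WAY — `eq_zero_of_mem_szSector_zero_odd` (`szSector N 0 = ⊥` for odd `N`),
   `not_isGroundStateInSector_zero_odd`, `matrixOddNumber_trivial`: with an ODD particle number `2⌊(1-δ)L²/2⌋ + 1` the
   hypothesis class is EMPTY (already at `L = 0`) and the matrix is trivially TRUE; the parity of `N_L` is what keeps the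
   matrix contentful, and every line stub typed with a free `N : ℕ` over `szSector N 0` (round-1 triage: card
   number-projected-canonical-slope's `ProjectedAttractiveChord`, the gentle-repulsion hull clause) inherits the
   vacuity / the junk sector energy `minEnergyOn _ ⊥ = sInf ∅ = 0` at odd `N`. Guard: `Even N` or `N := 2n`.
§5 FREE WEAKENING FOR THIS ROUTE — `BoxTransfer` (`U ∈ [2,3]`, `δ ∈ [1/5, 7/20]` only), `crux_imp_boxTransfer`,
   `closes_box : BoxTransfer → FixedPointDWaveOrder → HubbardSuperconductivity` (five lines, the route's `closes`
   with the box guard threaded): the route consumes the transfer ONLY on the target's box, so the `∀ U > 0`,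
   `∀ δ ∈ (0,1)` exposure is gratuitous. `boxTransfer_consistent_with_not_allForm` (abstract independence, witness
   matrix `:= U ≤ 3`): a refutation OUTSIDE the box — e.g. at a strong-coupling stripe/d-SC endpoint, §8 — would be
   `refuted-misstated` for route AposterioriCapRg with repair `C′ := BoxTransfer` (Lean: `∀ U ∈ Set.Icc (2:ℝ) 3,
   ∀ δ ∈ Set.Icc (1/5:ℝ) (7/20), ∀ μ, DensityMatched U δ μ → HasDWaveOrder U μ → HasDWavePairFieldLROAt U δ`).
   PLANNER NOTE 1 (DOC): kill criterion (c) of the route ("SsbToEvenTorusLro refuted inside the Hubbard family ⇒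
   pivot to a uniqueness / generic-U restatement") can be pre-empted for free by filing the box form now; nothing
   in `closes` changes but one `linarith` guard. PLANNER NOTE 2 (DOC, a design remark, not a finding): the route
   MANUFACTURES far more than `HasDWaveOrder U μ` at its point — [3] delivers a `HubbardScaleData` certificate `D`
   (stiffness, off-nodal gap, nodal velocities, remainder) valid `∀ h ∈ (0, h₀]`, and R turns it into the floor
   `m₀/2 ≤ m(U,μ)`; the transfer as filed throws `D` away and keeps only `0 < m`. An every-ground-state LRO proof on
   source-free tori is a tower-of-states / finite-size-gap argument, i.e. exactly the kind of statement for which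
   uniform-in-`h` stiffness and gap data are the natural input (KT1994 §3; Tasaki2019Tower §3); a transfer typed
   over `(D, h₀)` ("certified enclosure ∀ h ≤ h₀ ⇒ matrix at the certified density") would be weaker than this crux,
   still glue by logic after [3] and R, and immune to the endpoint hazard of §8 (a certificate valid on an
   `h`-interval at fixed `μ` excludes a competing `B1g`-poor phase degenerate at that `μ`, which would invalidate
   the enclosure at small `h`). Whether such a statement is provable is the provers' business; it is recorded here
   because the standing adversary's only kill configuration is one the route's own data would rule out.
§6 EVEN SIDES VERSUS ALL SIDES — `cruxAllSides_iff_crux`: the predecessor stmt-0157's ALL-sides matrix (with this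
   item's guards) is EQUIVALENT to the crux (`matrix_of_matrixAllSides`: re-fill odd sides with normalised sector
   ground states, tree `hasDWavePairFieldLROAt_admissible_nonempty`, `δ ≥ -1`; `pairFieldCorr_congr`): the item
   docstring's "a proof of 0157 gives this item … a refutation of this item refutes 0157" is machine-checked, and
   the even-`L` tailoring carries no content either way. `crux_of_cruxEvenDensity`: density matching may be asked
   on even (bipartite) sides only — a STRONGER statement implying the crux; odd tori are inessential for provers
   and useless for refuters (a witness needs all-sides `DensityMatched`). (Order side: the sibling's
   `dWaveOrderParameter_le_even`, same remark.)
§7 JUNK AUDIT ON THE FULL RANGE (+ the parity filter `densityMatched_parity_filter`, see §8(iii)) — `matrix_nonvacuous`: admissible sequences exist for every `U` and `δ ≥ -1`, so on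
   the NEW territory `δ ∈ [1/2, 1)` (not covered by the siblings' `δ < 1/2`) and at the degenerate small sides where
   `N_L = 0` the matrix is contentful; `L = 0` (empty torus, one-dimensional Fock space) and the junk value
   `pairFieldCorr _ _ 0 = 0` sit under a `liminf` and are immaterial; `HasLongRangeOrder`'s real `liminf` is of a
   bounded sequence (`|avg| ≤ C`), no `sSup ∅` junk; `Even L →` parses as intended (odd sides unconstrained AND
   unused). Read-back of coercions: `((L + 1 : ℕ) : ℝ) ^ 2`, `⌊(1 - δ) * (L:ℝ)^2 / 2⌋₊` (natural floor of a
   nonnegative real for `δ ≤ 1`), `(0:ℝ)` sector label `M = 0` cast to `ℂ` inside `szSector` — all honest.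
§8 HAZARD AUDIT (DOC) — where the `∀ U > 0, ∀ δ ∈ (0,1)` form is exposed beyond the siblings. The one configuration
   that falsifies a transfer of this shape (siblings §4/§5, Borgs–Kotecký finite-size rounding): a FIRST-ORDER (in
   `μ`) endpoint `μ_c(U)` between a `B1g`-ordered phase `X` and a `B1g`-POOR phase `Y` with `n_Y ∈ (0,1)`; for every
   `h > 0` the source selects `X` after `L → ∞` (linear gain `2hm_X L²`), so `HasDWaveOrder U μ_c`; if the source-free
   tori select `Y` at `μ_c` along all large sides (an `o(L²)` coin flip), `DensityMatched U (1-n_Y) μ_c` holds and the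
   crux demands `B1g` LRO of the pure-`Y` canonical states — false. Instances by regime: (i) WEAK COUPLING,
   `δ < 1/2`: the siblings' audit stands (AF/PS endpoint has `n_Y = 1`, excluded; `B1g→B2g`, `B1g→E` switches pass
   through continuous mixed `d+id`/`d+ip` phases at GL level — strict Cauchy–Schwarz of Fermi-curve quartics — and
   pure non-`B1g` phases have `m = 0`); (ii) NEW, `δ ∈ [1/2,1)` at weak coupling: KL theory puts `d_xy`/`p` there
   (RKS2010 Fig. 2: `d_{x²-y²}` only for `0.6 < n < 1`), so `m = 0` and the body is VACUOUS — the widened doping range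
   costs nothing; (iii) NEW, STRONG COUPLING `U ∼ 6–8`: the numerics place a non-superconducting filled-stripe
   regime at `0.1 < δ < 0.2` ("only short-range pairing occurs … U/t around 6-8 and dopings 0.1 < h < 0.2 … the
   system is not superconducting", QinEtAl2020 p. 2; "with t' = 0, stripe and superconductivity manifest as competing
   orders. Filled stripe states are particularly stable", XuEtAl2024 p. 5) next to d-wave regimes at larger doping /
   other couplings ("a BCS superconducting state of d-wave symmetry can emerge at weak coupling (U/t < 4) for doping
   h ≳ 0.3", ibid.; a "strong coupling d-wave superconducting phase" away from `1/8`, Sorella2023) — "it is a very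
   interesting question how this part of the phase diagram connects with the other parameter regimes" (QinEtAl2020
   p. 2). IF that connection is a first-order stripe/uniform-`d` boundary in `μ` with the tori selecting the stripe
   ALONG ALL LARGE SIDES, the triple `(U, 1-n_stripe, μ_c)` is a counterexample to THIS crux and to no sibling (they
   stop at `U < U₀`). SHARPENING (ideator k = 2, NOTES B3, checked and adopted; formal shell
   `densityMatched_parity_filter` / `not_densityMatched_of_parity_split`, §7): `DensityMatched` runs over ALL sides
   `L + 1`, odd (non-bipartite) tori included. A period-`p` stripe is frustrated on every torus with `p ∤ L`, and any
   `(π,π)`-entangled (antiphase / SDW) competitor is frustrated on every ODD torus, at an energy cost `≳ c·L` (a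
   defect line) against the `O(1)` finite-size splitting that decides the competition at `μ_c`; so on those sides the
   uniform `d`-wave phase wins, the tracial density tends to `n_X` there and to `n_Y` on the commensurate sides, the
   two partial limits differ, and `DensityMatched U δ μ_c` FAILS for every `δ` — the body is VACUOUS at the stripe
   endpoint. What survives as a kill configuration for the crux AS TYPED: a `B1g`-poor competitor that is
   translation-invariant (uniform pair-poor metal; uniform `d_xy`/`p` superconductor — but those switches are
   GL-continuous, (i)) or incommensurate with `O(1)` mismatch cost, degenerate with the `d`-wave phase at some
   `μ_c` and winning on all large tori; or ISO-DENSITY coexistence `n_X = n_Y` (codimension 2, non-generic). No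
   instance is identified in the numerical literature read. Not a theorem in any part, hence recorded, not filed;
   the free repair against ALL of (iii) remains §5 (the box).
   (iv) THE EVERY-GS CONTENT proper (the planner's why-might-fail: degenerate sector ground spaces, tower mixing):
   by the sibling's uniform-floor normal form the matrix demands, eventually in `k`, a UNIFORM floor `a > 0` under
   `(2k)⁻⁴ Re⟨ψ, Δ_d†Δ_d ψ⟩` over the WHOLE unit sphere of each sector ground eigenspace; open Fermi shells make these
   eigenspaces degenerate at `U = 0` for most even `L` — at the box dopings `δ = 1/5, 1/4, 3/10, 7/20` the `U = 0`
   shell of `N_L/2 = ⌊(1-δ)L²/2⌋` electrons per spin in `ε(k) = -2(cos k₁ + cos k₂)` is OPEN for 82, 72, 78, 84 of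
   the 99 even sides `4 ≤ L ≤ 200` (in-session arithmetic, this seat; 86/99 at `δ = 1/8`, 70/99 at `1/2`, 99/99 at
   `3/4`; the sibling's kit job j009802 found 81–91/99 on its window) — and symmetry multiplets (`±k`, `E` of
   `C_{4v}`) persist at `U > 0`. Physics expects every low-lying state of
   an ordered phase to carry the full `m²` (Koma–Tasaki tower; KT1994 Conjecture 10 is exactly "SSB ⇒ LRO of the
   finite-volume ground states", open in print: Tasaki2019Tower §3, WreszinskiZagrebnov2016 Rem. 4.5); no
   counterexample mechanism is known in ANY quantum lattice model with a unique infinite-volume KMS/ground structure,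
   and a model-level counterexample (order parameter `> 0`, some torus GS sequence order-poor) would itself be a
   notable theorem. This is why the crux "resists": both conjuncts of `not_crux_iff` are open problems, in opposite
   directions.
   (v) (gen 2) THE FERROMAGNETIC COMPETITOR — the cleanest surviving kill configuration of the `∀ U > 0` form, and a
   RIGOROUS one-sided mechanism. A saturated (Nagaoka) ferromagnet carries NO singlet pairs of any symmetry: route
   NoGo's landed crux 5 (`Summit.HubbardSuperconductivity.NoGo.localPair_mulVec_eq_zero_of_saturated`, Tasaki 1998
   p. 20) gives `P_x ψ = 0` for every max-spin `N`-particle `ψ`, including the `S^z = 0` member of the top multiplet,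
   which lies IN the summit's sector `(N_L, 0)` and is a ground state there iff the fully polarised sector attains the
   sector energy. Checked here: `SaturatedAt U δ L` (∃ saturated GS in `(N_L,0)`); `not_matrix_of_eventually_saturated`
   (FM on all large tori ⇒ `¬ HasDWavePairFieldLROAt U δ`, δ ≥ -1, any U) and `not_matrix_of_frequently_saturated`
   (FM on infinitely many EVEN tori suffices, δ ≥ 0 — via the sibling's landed uniform-floor normal form
   `WcbcsSsbToTorusLRO.Negative.floor_of_hasDWavePairFieldLROAt`); the ENERGY FORM `saturatedAt_iff_energy_eq`:
   `SaturatedAt U δ L ↔ E_min(N_L, S^z = N_L/2) = E_min(N_L, S^z = 0)` (§8f: `SU(2)` descent `saturated_descendant` /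
   ascent `saturated_ascent` between the fully polarised sector — a FREE SPINLESS BAND, `E = Σ` of the `N_L` lowest
   `ε(k)` — and the `S^z = 0` sector, with `‖S⁺u‖² = (n(n+1) - j(j+1))‖u‖²` from NoGo's spin algebra); and the crux
   reading `crux_imp_noOrder_of_eventually_saturated`: in an FM corner the crux ASSERTS absence of density-matched KT
   `d`-wave order (physically right: an FM has no singlet order, `m = 0`, body vacuous). WHY IT MATTERS: the FM is
   TRANSLATION-INVARIANT and unfrustrated on every torus, so the parity filter of (iii) does not touch it; a FIRST-ORDER
   boundary `μ_c(U)` between a singlet `d`-wave phase X and a saturated FM phase Y at strong coupling (no continuous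
   path between a singlet condensate and `S = N/2`: such a boundary, if the two phases meet, IS first order or goes
   through partially polarised phases) with the source-free tori selecting Y along all large sides is EXACTLY the
   configuration of §8 ¶1 with `n_Y ∈ (0,1)` and a conclusion that then fails IDENTICALLY (`pairFieldCorr ≡ 0`), not
   merely by a small margin. STATUS IN PRINT (Tasaki, Prog. Theor. Phys. 99 (1998) 489 = arXiv:cond-mat/9712219, read:
   §4.4 p. 17 "there are no rigorous results about the stability of Nagaoka's ferromagnetism … it is still not known if
   straightforward extensions of Nagaoka's ferromagnetism to finite U and finite hole density are possible"; rigorous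
   ABSENCE results are variational: DoucotWen89, Shastry90, Toth91, Suto91b, HanischUhrigMuellerHartmann97): the FM
   side is open at every finite density, the X/Y boundary is numerics at best — so, like (iii), recorded not filed.
   THE BOX IS PROVABLY IMMUNE (numbers): Tasaki 1998 Thm 3.2 (p. 12; one-line variational proof on ANY finite lattice:
   flip the top up-electron into the lowest level, `⟨Ψ,HΨ⟩ - E_ferro ≤ ε₁ - ε_{N_e} + U`) excludes `S_tot = S_max`
   whenever `0 ≤ U < ε_{N_e} - ε₁`, the spinless bandwidth occupied by `N_e = N_L` electrons; on the square torus
   `ε_{N_L} - ε₁ = 4 + ε_F,pol(1-δ)` = 5.86 (δ = 1/5), 5.44 (1/4), 5.06 (3/10), 4.72 (7/20) in the limit, ∈ [4.586, 6.236]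
   over ALL even `8 ≤ L ≤ 64` at the four box dopings δ ∈ {1/5, 1/4, 3/10, 7/20} (min at L = 8, δ = 7/20; max at L = 10,
   δ = 1/5) and ≥ 4.0 at L = 4, 6 (in-session lattice sums, this seat) — all `> 3 = U_max` of the box;
   the unpolarised free Slater determinant (Hartree bound `E_min(N_L,0) ≤ E_kin,unpol + U N_L²/(4L²)`) pushes the
   exclusion to `U < 4(e_pol - e_unpol)/n² ≈` 6.31 (n = 0.8), 6.41 (0.75), 6.59 (0.7), 6.84 (0.65) (margins 0.53, 0.48,
   0.44, 0.41 t/site at U = 3). So the FM kill configuration lives at `U ≳ 6` at the very least (numerics put Nagaoka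
   stability at `U/t` in the tens to hundreds) — INSIDE the crux's `∀ U > 0` range, OUTSIDE the box: the third
   independent reason (after §5 and (iii)) for PLANNER NOTE 1 (restate to `BoxTransfer`). Formalising Thm 3.2 on the
   torus (`U < ε_{N_L} - ε₁ → ¬ SaturatedAt U δ L`) needs plane-wave Slater determinants in the Fock matrix formalism
   (tree: only the `U = 0` partition-function route, `HubbardFreeTorusGroundEnergy`); left as the natural next negative
   lemma, interface = the energy form `saturatedAt_iff_energy_eq`.
   READING FOR PROVERS (gen 2, DOC). (1) All FOUR admissibility data must be consumed by any proof (§4b–d). (2) In the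
   `(N_L, 0)` ground space the singlet pair form `ψ ↦ Re⟨ψ, P†Pψ⟩` VANISHES on max-spin members (§8e) and nothing in the
   crux's hypotheses speaks about spin: a proof therefore contains, implicitly, an argument that density-matched KT
   order at `μ` excludes `S = N_L/2` ground states at the matched filling on all large even tori — at strong coupling
   this is genuine content (Nagaoka physics), inside the box it is free (Tasaki 1998 Thm 3.2, numbers in (v)); one more
   reason to prove `BoxTransfer` (§5) rather than the `∀ U > 0` form. (3) The energy form (§8f) is the interface for
   that exclusion: `¬ SaturatedAt U δ L ↔ E_min(N_L, 0) < E_min(N_L, N_L/2) = Σ_{j ≤ N_L} ε_j(L)` (free spinless band).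
§9 TARGETS — gen 2: none Lean-cheap. `targets = []`, `stuck_stubs = []`, no line picked (no `PICKED.md`, no `Lines/`).
   Pre-emptive pass over the round-1 card stubs (4 sketches): the Lean-decidable flaws are already filed by the triage
   panel (B1 `DiscreteLegendreRecentring` false at `n₀ = 0`: B1cex.lean / ScratchB1.lean / TriageB1.lean, three
   kernel-checked refutations + repair `1 ≤ n₀`); `ProjectedAttractiveChord`'s odd-`N` flaw (triage r1-1) is NOT
   Lean-closable without evaluating `dWaveSourceDensity` (at `L = 1` the `d`-wave pair field vanishes identically —
   `Σ_e g_d(e) = 0` over the collapsed bonds — so the smallest decidable instance has `d = 0` and the inequality holds;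
   at `L = 2` the sourced density is a 256-dimensional eigenproblem with irrational entries), recorded in §4e as the
   generic guard `Even N`; `LowManifoldRigidity` (fixed `τ`), `LocalFluxConvexityAt`, `PairYrastFloorAt` are physics
   claims with no finite decidable instance (the `∃ c α η M₀` prefix absorbs every small torus). §9 (gen 1): none that cycle (payload `targets = []`, `stuck_stubs = []`; no line picked for this item).
§10 NEAR-MISSES — none claimed; no `sorry` in this file.

Imports: the four Theses files are imported ONLY to state the sibling transports (§2) against the gate-written
decls; gen 2 adds route NoGo's landed `Theorems/NoGoNogoSingletPairKillsSaturatedFM` (saturated-FM lemmas, §8e) and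
the sibling's landed `Theorems/WcbcsSsbToTorusLRO/Negative/SummitMatrixUniformFloor` (uniform-floor normal form, §8e);
provers of this item should keep importing `…Theses.AposterioriCapRg` alone.
-/

noncomputable section

set_option linter.dupNamespace false

namespace Summit.HubbardSuperconductivity.HubbardSuperconductivity.Cruxes.SsbToEvenTorusLro.Disproof

open Literature.MathematicalPhysics.QuantumLattice Literature.Barriers.HubbardSuperconductivity
open Literature.Probability.LatticeModels
open Filter Set Matrix HubbardWave0
open scoped ComplexOrder
open _root_.Topology
open Summit.HubbardSuperconductivity.HubbardSuperconductivity.Theses.AposterioriCapRg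
  (SsbToEvenTorusLro FixedPointDWaveOrder Assembly)
open Summit.HubbardSuperconductivity.HubbardSuperconductivity.Theses.WeakCouplingBCS (WcbcsSsbToTorusLRO)
open Summit.HubbardSuperconductivity.HubbardSuperconductivity.Theses.ChiralWindow (CwSsbToEvenTorusLRO)

/-! ## §1 Normal forms -/

/-- The grand-canonical tracial ground-state density of `hubbardTorusWith 2 (L+1) 1 U μ`. -/
def gcDensity (U μ : ℝ) (L : ℕ) : ℝ :=
  ((hubbardTorusWith 2 (L + 1) 1 U μ).groundStateFunctional totalNumber).re / ((L + 1 : ℕ) : ℝ) ^ 2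

/-- Density matching: the GC tracial density tends to `1 - δ` along ALL sides `L + 1`. -/
def DensityMatched (U δ μ : ℝ) : Prop :=
  Tendsto (gcDensity U μ) atTop (𝓝 (1 - δ))

/-- The body of the crux at one parameter triple. -/
def Body (U δ μ : ℝ) : Prop :=
  DensityMatched U δ μ → HasDWaveOrder U μ → HasDWavePairFieldLROAt U δ

/-- The crux unfolded: ALL couplings `U > 0`, ALL dopings `δ ∈ (0,1)`, ALL `μ` (definitional; the inlined
conclusion is the barrier catalogue's `HasDWavePairFieldLROAt U δ` by `rfl`). -/
theorem crux_iff :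
    SsbToEvenTorusLro ↔ ∀ U δ μ : ℝ, 0 < U → δ ∈ Ioo (0:ℝ) 1 → Body U δ μ :=
  Iff.rfl

/-- Negation normal form. -/
theorem not_crux_iff :
    ¬ SsbToEvenTorusLro ↔ ∃ U δ μ : ℝ, 0 < U ∧ δ ∈ Ioo (0:ℝ) 1 ∧
      DensityMatched U δ μ ∧ HasDWaveOrder U μ ∧ ¬ HasDWavePairFieldLROAt U δ := by
  rw [crux_iff]
  simp only [Body, not_forall, exists_prop]

/-! ## §2 Position in the family of transfer cruxes: this is the TOP of the lattice -/

/-- `SsbToEvenTorusLro` implies the WeakCouplingBCS transfer crux (stmt-2009) for every window. -/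
theorem crux_imp_wcbcs (h : SsbToEvenTorusLro) : WcbcsSsbToTorusLRO :=
  ⟨1, one_pos, fun U hU δ hδ μ hd ho => h U δ μ hU.1 ⟨hδ.1, hδ.2.trans one_half_lt_one⟩ hd ho⟩

/-- … and the ChiralWindow copy (stmt-10439). -/
theorem crux_imp_cw (h : SsbToEvenTorusLro) : CwSsbToEvenTorusLRO :=
  ⟨1, one_pos, fun U hU δ hδ μ hd ho => h U δ μ hU.1 ⟨hδ.1, hδ.2.trans one_half_lt_one⟩ hd ho⟩

/-- … and the NodalWardXY copy. -/
theorem crux_imp_nodalWardXY (h : SsbToEvenTorusLro) :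
    Summit.HubbardSuperconductivity.HubbardSuperconductivity.Theses.NodalWardXY.SsbToTorusLRO :=
  ⟨1, one_pos, fun U hU δ hδ μ hd ho => h U δ μ hU.1 ⟨hδ.1, hδ.2.trans one_half_lt_one⟩ hd ho⟩

/-- Hence any refutation of the weak-coupling sibling kills this crux. -/
theorem not_crux_of_not_wcbcs (h : ¬ WcbcsSsbToTorusLRO) : ¬ SsbToEvenTorusLro :=
  mt crux_imp_wcbcs h

/-- With an arbitrary window `U₀` and the doping cap, exactly the sibling's `CruxWithoutWindow`-and-cap shape. -/
theorem crux_imp_window (h : SsbToEvenTorusLro) (U₀ : ℝ) :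
    ∀ U ∈ Ioo (0:ℝ) U₀, ∀ δ ∈ Ioo (0:ℝ) 1, ∀ μ : ℝ, Body U δ μ :=
  fun U hU δ hδ μ => h U δ μ hU.1 hδ

/-! ## §3 Why it resists (as theorems) -/

/-- Every disproof exhibits Koma–Tasaki d-wave order at SOME repulsive coupling. -/
theorem not_crux_imp_order (h : ¬ SsbToEvenTorusLro) : ∃ U μ : ℝ, 0 < U ∧ HasDWaveOrder U μ := by
  obtain ⟨U, δ, μ, hU, -, -, ho, -⟩ := not_crux_iff.1 h
  exact ⟨U, μ, hU, ho⟩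

/-- … at a density-matched chemical potential … -/
theorem not_crux_imp_densityMatched_order (h : ¬ SsbToEvenTorusLro) :
    ∃ U δ μ : ℝ, 0 < U ∧ δ ∈ Ioo (0:ℝ) 1 ∧ DensityMatched U δ μ ∧ HasDWaveOrder U μ := by
  obtain ⟨U, δ, μ, hU, hδ, hd, ho, -⟩ := not_crux_iff.1 h
  exact ⟨U, δ, μ, hU, hδ, hd, ho⟩

/-- … together with an ABSENCE-of-LRO theorem for interacting canonical ground states. -/
theorem not_crux_imp_noLRO (h : ¬ SsbToEvenTorusLro) :
    ∃ U δ : ℝ, 0 < U ∧ δ ∈ Ioo (0:ℝ) 1 ∧ ¬ HasDWavePairFieldLROAt U δ := by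
  obtain ⟨U, δ, μ, hU, hδ, -, -, hno⟩ := not_crux_iff.1 h
  exact ⟨U, δ, hU, hδ, hno⟩

/-- Absence of d-wave order at every repulsive coupling PROVES the crux (vacuously). -/
theorem crux_of_noOrder (h : ∀ U μ : ℝ, 0 < U → ¬ HasDWaveOrder U μ) : SsbToEvenTorusLro :=
  fun U _ μ hU _ _ ho => absurd ho (h U μ hU)

/-- Finer: absence of DENSITY-MATCHED d-wave order proves it. -/
theorem crux_of_noDensityMatchedOrder
    (h : ∀ U δ μ : ℝ, 0 < U → δ ∈ Ioo (0:ℝ) 1 → DensityMatched U δ μ → ¬ HasDWaveOrder U μ) :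
    SsbToEvenTorusLro :=
  fun U δ μ hU hδ hd ho => absurd ho (h U δ μ hU hδ hd)

/-- So does the summit matrix everywhere. -/
theorem crux_of_matrix (h : ∀ U δ : ℝ, 0 < U → δ ∈ Ioo (0:ℝ) 1 → HasDWavePairFieldLROAt U δ) :
    SsbToEvenTorusLro :=
  fun U δ _ hU hδ _ _ => h U δ hU hδ

/-- Contrapositive use at one point: where the matrix fails, the crux forbids density-matched order. -/
theorem crux_imp_noOrder_of_noLRO (h : SsbToEvenTorusLro) {U δ : ℝ} (hU : 0 < U) (hδ : δ ∈ Ioo (0:ℝ) 1)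
    (hno : ¬ HasDWavePairFieldLROAt U δ) : ∀ μ : ℝ, DensityMatched U δ μ → ¬ HasDWaveOrder U μ :=
  fun μ hd ho => hno (h U δ μ hU hδ hd ho)

/-- The catalogued OPEN stripe conjecture `PureModelStripeCompetition` (`¬ matrix` at `(8, 1/8)`) does not bite:
combined with the crux it only says there is no Koma–Tasaki d-wave order at `U = 8` at any `μ` density-matched to
`7/8` — consistent with the same numerics (no pairing response at `1/8`). -/
theorem crux_imp_noOrder_at_stripePoint (hs : PureModelStripeCompetition) (h : SsbToEvenTorusLro) :
    ∀ μ : ℝ, DensityMatched 8 (1 / 8) μ → ¬ HasDWaveOrder 8 μ :=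
  crux_imp_noOrder_of_noLRO h (by norm_num) ⟨by norm_num, by norm_num⟩ hs

/-! ## §4 Load-bearing lattice -/

/-- Drop `0 < U` (the parameter shape of the all-`L` predecessor stmt-0157). -/
def CruxWithoutPos : Prop :=
  ∀ U δ μ : ℝ, δ ∈ Ioo (0:ℝ) 1 → Body U δ μ

theorem crux_of_withoutPos (h : CruxWithoutPos) : SsbToEvenTorusLro :=
  fun U δ μ _ hδ => h U δ μ hδ

/-- Dropping `0 < U` adds exactly the free point `U = 0` and the attractive side `U < 0`. -/
theorem cruxWithoutPos_iff :
    CruxWithoutPos ↔ SsbToEvenTorusLro ∧ ∀ U δ μ : ℝ, U ≤ 0 → δ ∈ Ioo (0:ℝ) 1 → Body U δ μ := by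
  constructor
  · exact fun h => ⟨crux_of_withoutPos h, fun U δ μ _ hδ => h U δ μ hδ⟩
  · rintro ⟨h, h'⟩ U δ μ hδ
    rcases le_or_gt U 0 with hU | hU
    · exact h' U δ μ hU hδ
    · exact h U δ μ hU hδ

/-- Drop density matching. -/
def CruxWithoutDensity : Prop :=
  ∀ U δ μ : ℝ, 0 < U → δ ∈ Ioo (0:ℝ) 1 → HasDWaveOrder U μ → HasDWavePairFieldLROAt U δ

/-- Without density matching: order at ONE chemical potential forces canonical d-wave LRO at EVERY doping in
`(0,1)`, including the dilute limit `δ → 1`. -/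
theorem cruxWithoutDensity_iff :
    CruxWithoutDensity ↔
      ∀ U : ℝ, 0 < U → (∃ μ : ℝ, HasDWaveOrder U μ) → ∀ δ ∈ Ioo (0:ℝ) 1, HasDWavePairFieldLROAt U δ := by
  constructor
  · intro h U hU ⟨μ, hμ⟩ δ hδ
    exact h U δ μ hU hδ hμ
  · intro h U δ μ hU hδ hμ
    exact h U hU ⟨μ, hμ⟩ δ hδ

theorem crux_of_withoutDensity (h : CruxWithoutDensity) : SsbToEvenTorusLro :=
  fun U δ μ hU hδ _ ho => h U δ μ hU hδ ho

/-- Drop the order hypothesis. -/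
def CruxWithoutOrder : Prop :=
  ∀ U δ μ : ℝ, 0 < U → δ ∈ Ioo (0:ℝ) 1 → DensityMatched U δ μ → HasDWavePairFieldLROAt U δ

/-- Weaken `0 < m` to `0 ≤ m`. -/
def CruxWithNonnegOrder : Prop :=
  ∀ U δ μ : ℝ, 0 < U → δ ∈ Ioo (0:ℝ) 1 → DensityMatched U δ μ → 0 ≤ dWaveOrderParameter U μ →
    HasDWavePairFieldLROAt U δ

/-- `0 ≤ m` is a theorem (`dWaveOrderParameter_nonneg`): strict positivity is the entire load. -/
theorem cruxWithNonnegOrder_iff_withoutOrder : CruxWithNonnegOrder ↔ CruxWithoutOrder :=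
  ⟨fun h U δ μ hU hδ hd => h U δ μ hU hδ hd (dWaveOrderParameter_nonneg U μ),
    fun h U δ μ hU hδ hd _ => h U δ μ hU hδ hd⟩

theorem crux_of_withoutOrder (h : CruxWithoutOrder) : SsbToEvenTorusLro :=
  fun U δ μ hU hδ hd _ => h U δ μ hU hδ hd

/-! ### §4b The matrix-internal clauses: the ground-state clause is load-bearing UNCONDITIONALLY -/

/-- The summit matrix with the sector-ground-state clause dropped (normalisation kept). -/
def MatrixWithoutGS (δ : ℝ) : Prop :=
  ∀ (N : ℕ → ℕ) (ψ : ∀ L, Fock (Orb (FermionTorus 2 L))),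
    (∀ L, Even L → N L = 2 * ⌊(1 - δ) * (L : ℝ) ^ 2 / 2⌋₊ ∧ star (ψ L) ⬝ᵥ ψ L = 1) →
      HasLongRangeOrder (fun k => halfOpenBox 2 (2 * k))
        (fun k => torusPullback (pairFieldCorr dWaveFormFactor ψ) (2 * k))

/-- The vacuum sequence. -/
def vacSeq : ∀ L, Fock (Orb (FermionTorus 2 L)) := fun _ => vacuum

theorem star_vacuum_dotProduct_vacuum {ι : Type*} [LinearOrder ι] [Fintype ι] :
    star (vacuum : Fock ι) ⬝ᵥ vacuum = 1 := by
  simp [vacuum, dotProduct_single]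

/-- Every local pair operator annihilates the vacuum. -/
theorem localPair_mulVec_vacuum (g : Site 2 → ℝ) (L : ℕ) [NeZero L] (x : TorusSite 2 L) :
    localPair g L x *ᵥ (vacuum : Fock (Orb (FermionTorus 2 L))) = 0 := by
  have han : ∀ (A : Matrix (Finset (Orb (FermionTorus 2 L))) (Finset (Orb (FermionTorus 2 L))) ℂ)
      (i : Orb (FermionTorus 2 L)), (A * annihilation i) *ᵥ (vacuum : Fock (Orb (FermionTorus 2 L))) = 0 :=
    fun A i => by rw [← mulVec_mulVec, annihilation_mulVec_vacuum_holds, mulVec_zero]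
  simp only [localPair, sum_mulVec, smul_mulVec, sub_mulVec, han, sub_zero, smul_zero,
    Finset.sum_const_zero]

/-- The pair correlations of the vacuum sequence vanish identically. -/
theorem pairFieldCorr_vacSeq (g : Site 2 → ℝ) (L : ℕ) (x y : TorusSite 2 L) :
    pairFieldCorr g vacSeq L x y = 0 := by
  cases L with
  | zero => rfl
  | succ L =>
    rw [pairFieldCorr_succ, expect, ← mulVec_mulVec]
    simp [vacSeq, localPair_mulVec_vacuum]

/-- **The ground-state clause is load-bearing, unconditionally**: without it the matrix is FALSE at every
doping (witness: the normalised vacuum sequence, whose `d`-wave pair correlations vanish identically). -/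
theorem not_matrixWithoutGS (δ : ℝ) : ¬ MatrixWithoutGS δ := by
  intro h
  have hl := h (fun L => 2 * ⌊(1 - δ) * (L : ℝ) ^ 2 / 2⌋₊) vacSeq
    (fun L _ => ⟨rfl, star_vacuum_dotProduct_vacuum⟩)
  unfold HasLongRangeOrder at hl
  simp only [torusPullback_apply, pairFieldCorr_vacSeq, Finset.sum_const_zero, zero_div,
    liminf_const] at hl
  exact lt_irrefl _ hl

/-- The crux with the ground-state clause dropped from its conclusion. -/
def CruxWithoutGS : Prop :=
  ∀ U δ μ : ℝ, 0 < U → δ ∈ Ioo (0:ℝ) 1 → DensityMatched U δ μ → HasDWaveOrder U μ → MatrixWithoutGS δ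

/-- Dropping the ground-state clause turns the crux into the ABSENCE thesis: no density-matched Koma–Tasaki
d-wave order anywhere in the repulsive Hubbard model. -/
theorem cruxWithoutGS_iff_absence :
    CruxWithoutGS ↔ ∀ U δ μ : ℝ, 0 < U → δ ∈ Ioo (0:ℝ) 1 → DensityMatched U δ μ → ¬ HasDWaveOrder U μ :=
  ⟨fun h U δ μ hU hδ hd ho => not_matrixWithoutGS δ (h U δ μ hU hδ hd ho),
    fun h U δ μ hU hδ hd ho => absurd ho (h U δ μ hU hδ hd)⟩

/-! ### §4c The normalisation clause and the particle-number clause are load-bearing too (unconditionally) -/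

/-- `⟨cφ, A cφ⟩ = c̄c⟨φ, Aφ⟩` (real part: `‖c‖² Re⟨φ, Aφ⟩`). -/
theorem re_expect_smul {L : ℕ} (A : Matrix (Finset (Orb (FermionTorus 2 L))) (Finset (Orb (FermionTorus 2 L))) ℂ)
    (c : ℂ) (φ : Fock (Orb (FermionTorus 2 L))) :
    (expect A (c • φ)).re = ‖c‖ ^ 2 * (expect A φ).re := by
  have h : expect A (c • φ) = (starRingEnd ℂ c * c) * expect A φ := by
    rw [expect, expect, Matrix.mulVec_smul, star_smul, smul_dotProduct, dotProduct_smul, smul_eq_mul,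
      smul_eq_mul, ← mul_assoc, Complex.star_def]
  rw [h, Complex.conj_mul', ← Complex.ofReal_pow, Complex.re_ofReal_mul]

/-- Pair correlations are quadratic in the state: scaling `ψ L` by `c L` scales them by `‖c L‖²`. -/
theorem pairFieldCorr_smul (g : Site 2 → ℝ) (c : ℕ → ℂ) (ψ : ∀ L, Fock (Orb (FermionTorus 2 L)))
    (L : ℕ) (x y : TorusSite 2 L) :
    pairFieldCorr g (fun L => c L • ψ L) L x y = ‖c L‖ ^ 2 * pairFieldCorr g ψ L x y := by
  cases L with
  | zero => simp [pairFieldCorr]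
  | succ L => rw [pairFieldCorr_succ, pairFieldCorr_succ, re_expect_smul]

/-- The summit matrix with the NORMALISATION clause dropped (sector-ground-state clause kept). -/
def MatrixWithoutNorm (U δ : ℝ) : Prop :=
  ∀ (N : ℕ → ℕ) (ψ : ∀ L, Fock (Orb (FermionTorus 2 L))),
    (∀ L, Even L → N L = 2 * ⌊(1 - δ) * (L : ℝ) ^ 2 / 2⌋₊ ∧
        IsGroundStateInSector (hubbardTorus 2 L 1 U) (N L) 0 (ψ L)) →
      HasLongRangeOrder (fun k => halfOpenBox 2 (2 * k))
        (fun k => torusPullback (pairFieldCorr dWaveFormFactor ψ) (2 * k))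

/-- The box average of the pulled-back pair correlations at side `L` (the sequence inside `HasLongRangeOrder`,
before restriction to even sides). -/
def boxAvg (ψ : ∀ L, Fock (Orb (FermionTorus 2 L))) (L : ℕ) : ℝ :=
  (∑ x ∈ halfOpenBox 2 L, ∑ y ∈ halfOpenBox 2 L, torusPullback (pairFieldCorr dWaveFormFactor ψ) L x y) /
    ((halfOpenBox 2 L).card : ℝ) ^ 2

theorem hasLongRangeOrder_iff_boxAvg (ψ : ∀ L, Fock (Orb (FermionTorus 2 L))) :
    HasLongRangeOrder (fun k => halfOpenBox 2 (2 * k))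
        (fun k => torusPullback (pairFieldCorr dWaveFormFactor ψ) (2 * k)) ↔
      0 < liminf (fun k => boxAvg ψ (2 * k)) atTop :=
  Iff.rfl

theorem boxAvg_smul (c : ℕ → ℂ) (ψ : ∀ L, Fock (Orb (FermionTorus 2 L))) (L : ℕ) :
    boxAvg (fun L => c L • ψ L) L = ‖c L‖ ^ 2 * boxAvg ψ L := by
  simp only [boxAvg, torusPullback_apply, pairFieldCorr_smul, ← Finset.mul_sum]
  ring

/-- **The normalisation clause is load-bearing, unconditionally**: without it the matrix is FALSE at every `U`
and every `δ ≥ -1` (witness: sector ground states — they exist on every torus — scaled down by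
`((L+1)√(1+|avg_L|))⁻¹`, which stay sector ground states while their box averages are `≤ (L+1)⁻²`). -/
theorem not_matrixWithoutNorm (U : ℝ) {δ : ℝ} (hδ : -1 ≤ δ) : ¬ MatrixWithoutNorm U δ := by
  intro h
  obtain ⟨N, ψ, hadm⟩ := hasDWavePairFieldLROAt_admissible_nonempty U hδ
  set r : ℕ → ℝ := fun L => 1 / (((L : ℝ) + 1) * Real.sqrt (1 + |boxAvg ψ L|)) with hr
  have hrpos : ∀ L, 0 < r L := fun L => by
    have : 0 < Real.sqrt (1 + |boxAvg ψ L|) := Real.sqrt_pos.2 (by positivity)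
    positivity
  set c : ℕ → ℂ := fun L => ((r L : ℝ) : ℂ) with hc
  have hcne : ∀ L, c L ≠ 0 := fun L => by
    simp only [hc, ne_eq, Complex.ofReal_eq_zero]; exact (hrpos L).ne'
  have hnorm : ∀ L, ‖c L‖ ^ 2 = 1 / (((L : ℝ) + 1) ^ 2 * (1 + |boxAvg ψ L|)) := fun L => by
    have hs : 0 ≤ 1 + |boxAvg ψ L| := by positivity
    have h1 : ‖c L‖ = r L := by
      simp only [hc, Complex.norm_real, Real.norm_eq_abs]
      exact abs_of_pos (hrpos L)
    rw [h1, hr]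
    show (1 / (((L : ℝ) + 1) * Real.sqrt (1 + |boxAvg ψ L|))) ^ 2 = _
    rw [div_pow, one_pow, mul_pow, Real.sq_sqrt hs]
  have hl := h N (fun L => c L • ψ L) fun L hL => ⟨(hadm L).1, isGroundStateInSector_smul (hadm L).2.2 (hcne L)⟩
  rw [hasLongRangeOrder_iff_boxAvg] at hl
  have hbound : ∀ k : ℕ, ‖boxAvg (fun L => c L • ψ L) (2 * k)‖ ≤ 1 / ((k : ℝ) + 1) := fun k => by
    rw [boxAvg_smul, hnorm, Real.norm_eq_abs, abs_mul, abs_of_nonneg (by positivity), div_mul_eq_mul_div, one_mul]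
    have hA : 0 ≤ |boxAvg ψ (2 * k)| := abs_nonneg _
    have hk : (0 : ℝ) ≤ k := Nat.cast_nonneg k
    rw [div_le_div_iff₀ (by positivity) (by positivity)]
    push_cast
    nlinarith [mul_nonneg hk hA, mul_nonneg (mul_nonneg hk hk) hA]
  have ht : Tendsto (fun k => boxAvg (fun L => c L • ψ L) (2 * k)) atTop (𝓝 0) :=
    squeeze_zero_norm hbound tendsto_one_div_add_atTop_nhds_zero_nat
  rw [ht.liminf_eq] at hl
  exact lt_irrefl _ hl

/-- The summit matrix with the PARTICLE-NUMBER clause dropped (both other clauses kept; `N` free). -/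
def MatrixWithoutNumber (U : ℝ) : Prop :=
  ∀ (N : ℕ → ℕ) (ψ : ∀ L, Fock (Orb (FermionTorus 2 L))),
    (∀ L, Even L → star (ψ L) ⬝ᵥ ψ L = 1 ∧ IsGroundStateInSector (hubbardTorus 2 L 1 U) (N L) 0 (ψ L)) →
      HasLongRangeOrder (fun k => halfOpenBox 2 (2 * k))
        (fun k => torusPullback (pairFieldCorr dWaveFormFactor ψ) (2 * k))

/-- A zero-particle vector is a multiple of the vacuum. -/
theorem eq_smul_vacuum_of_isNParticle_zero {ι : Type*} [LinearOrder ι] {φ : Fock ι} (h : IsNParticle 0 φ) :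
    φ = φ ∅ • (vacuum : Fock ι) := by
  funext s
  by_cases hs : s = ∅
  · subst hs; simp [vacuum]
  · have : φ s = 0 := h s (by rwa [ne_eq, Finset.card_eq_zero])
    simp [vacuum, hs, this]

/-- **The particle-number clause is load-bearing, unconditionally**: with `N` free, the normalised ground states
of the EMPTY sector `(N, S^z) = (0, 0)` (multiples of the vacuum; they exist on every torus) are admissible and have
identically vanishing pair correlations. -/
theorem not_matrixWithoutNumber (U : ℝ) : ¬ MatrixWithoutNumber U := by
  intro h
  have key : ∀ L : ℕ, ∃ φ : Fock (Orb (FermionTorus 2 L)), star φ ⬝ᵥ φ = 1 ∧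
      IsGroundStateInSector (hubbardTorus 2 L 1 U) (2 * 0) 0 φ :=
    fun L => exists_unit_isGroundStateInSector_hubbardTorus U L 0 (Nat.zero_le _)
  choose φ hφ using key
  have hvac : ∀ L, φ L = φ L ∅ • (vacuum : Fock (Orb (FermionTorus 2 L))) := fun L =>
    eq_smul_vacuum_of_isNParticle_zero ((mem_szSector_iff _ _ _).1 (hφ L).2.1).1
  have hl := h (fun _ => 0) φ fun L _ => ⟨(hφ L).1, by simpa using (hφ L).2⟩
  have hzero : ∀ (k : ℕ) (x y : TorusSite 2 (2 * k)), pairFieldCorr dWaveFormFactor φ (2 * k) x y = 0 := by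
    intro k x y
    have e : φ = fun L => (φ L ∅) • vacSeq L := funext fun L => hvac L
    rw [e, pairFieldCorr_smul, pairFieldCorr_vacSeq, mul_zero]
  unfold HasLongRangeOrder at hl
  simp only [torusPullback_apply, hzero, Finset.sum_const_zero, zero_div, liminf_const] at hl
  exact lt_irrefl _ hl

/-! ## §5 Free weakening for route AposterioriCapRg: only the box is consumed -/

/-- The transfer on the target's box `U ∈ [2,3]`, `δ ∈ [1/5, 7/20]` only. -/
def BoxTransfer : Prop :=
  ∀ U ∈ Icc (2:ℝ) 3, ∀ δ ∈ Icc (1/5:ℝ) (7/20), ∀ μ : ℝ, Body U δ μ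

theorem box_subset : ∀ U ∈ Icc (2:ℝ) 3, ∀ δ ∈ Icc (1/5:ℝ) (7/20), 0 < U ∧ δ ∈ Ioo (0:ℝ) 1 :=
  fun U hU δ hδ => ⟨by linarith [hU.1], by linarith [hδ.1], by linarith [hδ.2]⟩

theorem crux_imp_boxTransfer (h : SsbToEvenTorusLro) : BoxTransfer :=
  fun U hU δ hδ μ => h U δ μ (box_subset U hU δ hδ).1 (box_subset U hU δ hδ).2

/-- The route still closes from the BOX transfer and the target `FixedPointDWaveOrder` as filed (compare the
route file's `closes`). -/
theorem closes_box (hS : BoxTransfer) (hT : FixedPointDWaveOrder) : _root_.HubbardSuperconductivity := by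
  obtain ⟨U, hU, δ, hδ, μ, hdens, hord⟩ := hT
  have hU0 : (0 : ℝ) < U := by linarith [hU.1]
  unfold HubbardSuperconductivity Literature.Hubbard.DWaveSuperconductivityHubbard
  refine ⟨U, hU0, δ, ⟨by linarith [hδ.1], by linarith [hδ.2]⟩, ?_⟩
  exact hS U hU δ hδ μ hdens hord

/-- Abstract independence: for SOME interpretation of the three atoms (density matching, order parameter in
`[0, 4√2]`, matrix) the box transfer holds while the all-`(U, δ)` form fails (witness: matrix `:= U ≤ 3`, failing
at the stripe point `U = 8`). A refutation of the crux OUTSIDE the box is `refuted-misstated` for this route. -/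
theorem boxTransfer_consistent_with_not_allForm :
    ∃ (D : ℝ → ℝ → ℝ → Prop) (m : ℝ → ℝ → ℝ) (M : ℝ → ℝ → Prop),
      (∀ U μ, 0 ≤ m U μ ∧ m U μ ≤ 4 * Real.sqrt 2) ∧
        (∀ U ∈ Icc (2:ℝ) 3, ∀ δ ∈ Icc (1/5:ℝ) (7/20), ∀ μ : ℝ, D U δ μ → 0 < m U μ → M U δ) ∧
          ¬ (∀ U δ μ : ℝ, 0 < U → δ ∈ Ioo (0:ℝ) 1 → D U δ μ → 0 < m U μ → M U δ) := by
  refine ⟨fun _ _ _ => True, fun _ _ => 1, fun U _ => U ≤ 3, fun _ _ => ⟨zero_le_one, ?_⟩,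
    fun U hU δ _ μ _ _ => hU.2, fun h => ?_⟩
  · have : (1:ℝ) ≤ Real.sqrt 2 := Real.one_le_sqrt.2 (by norm_num)
    linarith
  · have := h 8 (1 / 8) 0 (by norm_num) ⟨by norm_num, by norm_num⟩ trivial one_pos
    norm_num at this

/-! ## §6 Even sides versus all sides -/

/-- The matrix with the admissibility hypothesis on ALL sides (the shape of the predecessor stmt-0157). -/
def MatrixAllSides (U δ : ℝ) : Prop :=
  ∀ (N : ℕ → ℕ) (ψ : ∀ L, Fock (Orb (FermionTorus 2 L))),
    (∀ L, N L = 2 * ⌊(1 - δ) * (L : ℝ) ^ 2 / 2⌋₊ ∧ star (ψ L) ⬝ᵥ ψ L = 1 ∧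
        IsGroundStateInSector (hubbardTorus 2 L 1 U) (N L) 0 (ψ L)) →
      HasLongRangeOrder (fun k => halfOpenBox 2 (2 * k))
        (fun k => torusPullback (pairFieldCorr dWaveFormFactor ψ) (2 * k))

/-- Constraining odd sides too only shrinks the family of sequences: the even-side matrix implies it. -/
theorem matrixAllSides_of_matrix {U δ : ℝ} (h : HasDWavePairFieldLROAt U δ) : MatrixAllSides U δ :=
  fun N ψ hψ => h N ψ fun L _ => hψ L

/-- The all-sides crux (stmt-0157's matrix with this item's parameter guards). -/
def CruxAllSides : Prop :=
  ∀ U δ μ : ℝ, 0 < U → δ ∈ Ioo (0:ℝ) 1 → DensityMatched U δ μ → HasDWaveOrder U μ → MatrixAllSides U δ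

theorem crux_imp_cruxAllSides (h : SsbToEvenTorusLro) : CruxAllSides :=
  fun U δ μ hU hδ hd ho => matrixAllSides_of_matrix (h U δ μ hU hδ hd ho)

/-- `pairFieldCorr g ψ L` depends on `ψ` only through `ψ L`. -/
theorem pairFieldCorr_congr (g : Site 2 → ℝ) {ψ ψ' : ∀ L, Fock (Orb (FermionTorus 2 L))} {L : ℕ}
    (h : ψ L = ψ' L) : pairFieldCorr g ψ L = pairFieldCorr g ψ' L := by
  cases L with
  | zero => rfl
  | succ L => funext x y; rw [pairFieldCorr_succ, pairFieldCorr_succ, h]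

/-- **The even-side tailoring is immaterial**: the all-sides matrix implies the even-side matrix, because an
even-admissible sequence can be re-filled at odd sides by normalised sector ground states, which exist on every
torus (tree `exists_unit_isGroundStateInSector_hubbardTorus`, `natFloor_filling_le_sq`; needs `δ ≥ -1`), without
changing any term of the conclusion. -/
theorem matrix_of_matrixAllSides {U δ : ℝ} (hδ : -1 ≤ δ) (h : MatrixAllSides U δ) : HasDWavePairFieldLROAt U δ := by
  intro N ψ hψ
  obtain ⟨N', φ, hφ⟩ := hasDWavePairFieldLROAt_admissible_nonempty U hδ
  classical
  let ψ'' : ∀ L, Fock (Orb (FermionTorus 2 L)) := fun L => if Even L then ψ L else φ L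
  have hadm : ∀ L, N' L = 2 * ⌊(1 - δ) * (L : ℝ) ^ 2 / 2⌋₊ ∧ star (ψ'' L) ⬝ᵥ ψ'' L = 1 ∧
      IsGroundStateInSector (hubbardTorus 2 L 1 U) (N' L) 0 (ψ'' L) := by
    intro L
    by_cases hL : Even L
    · obtain ⟨hN, hn, hg⟩ := hψ L hL
      refine ⟨(hφ L).1, ?_, ?_⟩
      · simp only [ψ'', if_pos hL]; exact hn
      · simp only [ψ'', if_pos hL]; rw [(hφ L).1, ← hN]; exact hg
    · refine ⟨(hφ L).1, ?_, ?_⟩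
      · simp only [ψ'', if_neg hL]; exact (hφ L).2.1
      · simp only [ψ'', if_neg hL]; exact (hφ L).2.2
  have hl := h N' ψ'' hadm
  have heq : (fun k => torusPullback (pairFieldCorr dWaveFormFactor ψ'') (2 * k)) =
      fun k => torusPullback (pairFieldCorr dWaveFormFactor ψ) (2 * k) := by
    funext k x y
    have hk : ψ'' (2 * k) = ψ (2 * k) := by simp only [ψ'', if_pos (even_two_mul k)]
    simp only [torusPullback_apply, pairFieldCorr_congr dWaveFormFactor hk]
  rwa [heq] at hl

/-- Hence, on dopings `δ ≥ -1` (in particular on the crux's range), the two matrices coincide … -/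
theorem matrixAllSides_iff_matrix {U δ : ℝ} (hδ : -1 ≤ δ) : MatrixAllSides U δ ↔ HasDWavePairFieldLROAt U δ :=
  ⟨matrix_of_matrixAllSides hδ, matrixAllSides_of_matrix⟩

/-- … and **the all-sides crux (the predecessor stmt-0157's matrix with this item's guards) is EQUIVALENT to the
crux**: "a proof of 0157 gives this item, a refutation of this item refutes 0157" (item docstring), machine-checked. -/
theorem cruxAllSides_iff_crux : CruxAllSides ↔ SsbToEvenTorusLro :=
  ⟨fun h U δ μ hU hδ hd ho => matrix_of_matrixAllSides (by linarith [hδ.1]) (h U δ μ hU hδ hd ho),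
    crux_imp_cruxAllSides⟩

/-! ## §7 Junk audit of the matrix on the FULL range `δ ∈ (0,1)` (proved) -/

/-- The hypothesis class of the conclusion is inhabited at every `(U, δ)` of the crux's range (and beyond:
`δ ≥ -1`), including the new territory `δ ∈ [1/2, 1)` not covered by the siblings and the degenerate small sides
where `N_L = 0` (vacuum sector): the matrix is never true for want of admissible sequences. -/
theorem matrix_nonvacuous (U : ℝ) {δ : ℝ} (hδ : -1 ≤ δ) (h : HasDWavePairFieldLROAt U δ) :
    ∃ (N : ℕ → ℕ) (ψ : ∀ L, Fock (Orb (FermionTorus 2 L))),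
      (∀ L, Even L → N L = 2 * ⌊(1 - δ) * (L : ℝ) ^ 2 / 2⌋₊ ∧ star (ψ L) ⬝ᵥ ψ L = 1 ∧
          IsGroundStateInSector (hubbardTorus 2 L 1 U) (N L) 0 (ψ L)) ∧
        HasLongRangeOrder (fun k => halfOpenBox 2 (2 * k))
          (fun k => torusPullback (pairFieldCorr dWaveFormFactor ψ) (2 * k)) := by
  obtain ⟨N, ψ, hadm⟩ := hasDWavePairFieldLROAt_admissible_nonempty U hδ
  exact ⟨N, ψ, fun L _ => hadm L, h N ψ fun L _ => hadm L⟩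

/-- Density matching along EVEN sides only (sides `2k + 2`, i.e. indices `L = 2k + 1`). -/
def DensityMatchedEven (U δ μ : ℝ) : Prop :=
  Tendsto (fun k : ℕ => gcDensity U μ (2 * k + 1)) atTop (𝓝 (1 - δ))

theorem DensityMatched.even {U δ μ : ℝ} (h : DensityMatched U δ μ) : DensityMatchedEven U δ μ :=
  h.comp (tendsto_atTop_atTop.2 fun b => ⟨b, fun k hk => by omega⟩)

/-- The crux with density matching asked on even sides only (weaker hypothesis, stronger statement). -/
def CruxEvenDensity : Prop :=
  ∀ U δ μ : ℝ, 0 < U → δ ∈ Ioo (0:ℝ) 1 → DensityMatchedEven U δ μ → HasDWaveOrder U μ → HasDWavePairFieldLROAt U δ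

/-- Odd (non-bipartite) tori in the density hypothesis are inessential for provers: the even-sides-density crux
implies the crux. (Refuters gain nothing from odd sides either: a witness needs `DensityMatched`, all sides.) -/
theorem crux_of_cruxEvenDensity (h : CruxEvenDensity) : SsbToEvenTorusLro :=
  fun U δ μ hU hδ hd ho => h U δ μ hU hδ (DensityMatched.even hd) ho

/-- Density matching along ODD sides only (sides `2k + 1`, i.e. indices `L = 2k`; non-bipartite tori). -/
def DensityMatchedOdd (U δ μ : ℝ) : Prop :=
  Tendsto (fun k : ℕ => gcDensity U μ (2 * k)) atTop (𝓝 (1 - δ))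

theorem DensityMatched.odd {U δ μ : ℝ} (h : DensityMatched U δ μ) : DensityMatchedOdd U δ μ :=
  h.comp (tendsto_atTop_atTop.2 fun b => ⟨b, fun k hk => by omega⟩)

/-- **The parity (commensurability) filter, formal shell.** If the GC tracial densities converge to `a` along the
odd sides and to `b` along the even sides, density matching at doping `δ` forces `a = b = 1 - δ`. Reading (§8(iii),
adopted from ideator k = 2's NOTES B3 after check): a competitor phase selected by the source-free tori only on a
commensurate sub-family of sides (stripes of period `p` on `p ∣ L`; `(π,π)`-entangled states on even `L`, frustrated
at cost `≳ L` on odd tori) makes the two partial limits differ (`n_X ≠ n_Y`), so `DensityMatched` FAILS and the body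
is vacuous there: the kill configuration needs a competitor winning on ALL large sides (translation-invariant or
incommensurate), or iso-density coexistence `n_X = n_Y` (codimension 2). -/
theorem densityMatched_parity_filter {U δ μ a b : ℝ}
    (hodd : Tendsto (fun k : ℕ => gcDensity U μ (2 * k)) atTop (𝓝 a))
    (heven : Tendsto (fun k : ℕ => gcDensity U μ (2 * k + 1)) atTop (𝓝 b))
    (h : DensityMatched U δ μ) : a = 1 - δ ∧ b = 1 - δ :=
  ⟨tendsto_nhds_unique hodd h.odd, tendsto_nhds_unique heven h.even⟩

/-- Contrapositive: two different partial limits along the two parities exclude density matching at EVERY doping. -/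
theorem not_densityMatched_of_parity_split {U μ a b : ℝ} (hab : a ≠ b)
    (hodd : Tendsto (fun k : ℕ => gcDensity U μ (2 * k)) atTop (𝓝 a))
    (heven : Tendsto (fun k : ℕ => gcDensity U μ (2 * k + 1)) atTop (𝓝 b)) (δ : ℝ) :
    ¬ DensityMatched U δ μ := fun h =>
  hab ((densityMatched_parity_filter hodd heven h).1.trans (densityMatched_parity_filter hodd heven h).2.symm)

/-! ### §4d (gen 2) The `S^z = 0` label is load-bearing too: fully polarised sectors carry no singlet pairs -/

section NoDown

variable {Λ : Type*} [LinearOrder Λ] [Fintype Λ]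

/-- `ψ` has no down-spin electrons: it is supported on configurations without `↓` orbitals. -/
def NoDown (ψ : Fock (Orb Λ)) : Prop :=
  ∀ (s : Finset (Orb Λ)) (y : Λ), orb y 1 ∈ s → ψ s = 0

/-- Every down annihilator kills a vector with no down electrons. -/
theorem annihilation_down_mulVec_of_noDown {ψ : Fock (Orb Λ)} (h : NoDown ψ) (y : Λ) :
    annihilation (orb y 1) *ᵥ ψ = 0 := by
  funext s
  rw [annihilation_mulVec_apply, Pi.zero_apply]
  split_ifs with hy
  · rfl
  · rw [h (insert (orb y 1) s) y (Finset.mem_insert_self _ _), mul_zero]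

/-- Annihilators preserve the absence of down electrons. -/
theorem noDown_annihilation_mulVec {ψ : Fock (Orb Λ)} (h : NoDown ψ) (i : Orb Λ) :
    NoDown (annihilation i *ᵥ ψ) := by
  intro s y hy
  rw [annihilation_mulVec_apply]
  split_ifs with hi
  · rfl
  · rw [h (insert i s) y (Finset.mem_insert_of_mem hy), mul_zero]

/-- Membership in the FULLY POLARISED sector `(N, S^z = N/2)`: support on configurations with `N` up and
no down electrons. -/
theorem mem_szSector_top_iff (N : ℕ) (ψ : Fock (Orb Λ)) :
    ψ ∈ szSector N ((N : ℝ) / 2) ↔ ∀ s, ¬((upPart s).card = N ∧ (downPart s).card = 0) → ψ s = 0 := by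
  rw [mem_szSector_iff]
  constructor
  · rintro ⟨hN, hZ⟩ s hs
    by_cases hcard : s.card = N
    · by_contra hψ
      have h := congrFun hZ s
      rw [LiebThm1.spinZ_mulVec_apply, Pi.smul_apply, smul_eq_mul] at h
      have h' : (1 / 2 : ℂ) * (((upPart s).card : ℂ) - ((downPart s).card : ℂ)) = (((N : ℝ) / 2 : ℝ) : ℂ) :=
        mul_right_cancel₀ hψ h
      have hre := congrArg Complex.re h'
      simp only [Complex.mul_re, Complex.sub_re, Complex.natCast_re, Complex.sub_im, Complex.natCast_im,
        sub_self, mul_zero, sub_zero, Complex.ofReal_re] at hre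
      norm_num at hre
      have hsum : ((upPart s).card : ℝ) + ((downPart s).card : ℝ) = N := by
        rw [← Nat.cast_add, ← card_eq_upPart_add_downPart, hcard]
      have hd : ((downPart s).card : ℝ) = 0 := by linarith
      have hu : ((upPart s).card : ℝ) = N := by linarith
      exact hs ⟨by exact_mod_cast hu, by exact_mod_cast hd⟩
    · exact hN s hcard
  · intro h
    refine ⟨fun s hs => h s fun hc => hs ?_, ?_⟩
    · rw [card_eq_upPart_add_downPart, hc.1, hc.2, add_zero]
    · funext s
      rw [LiebThm1.spinZ_mulVec_apply, Pi.smul_apply, smul_eq_mul]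
      by_cases hc : (upPart s).card = N ∧ (downPart s).card = 0
      · rw [hc.1, hc.2]
        push_cast
        ring
      · rw [h s hc, mul_zero, mul_zero]

/-- Vectors of the fully polarised sector have no down electrons. -/
theorem noDown_of_mem_szSector_top {N : ℕ} {ψ : Fock (Orb Λ)} (h : ψ ∈ szSector N ((N : ℝ) / 2)) :
    NoDown ψ := by
  intro s y hy
  refine (mem_szSector_top_iff N ψ).1 h s fun hc => ?_
  have hy' : y ∈ downPart s := (mem_downPart s y).2 hy
  rw [Finset.card_eq_zero] at hc
  simp [hc.2] at hy'

end NoDown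

/-- Every local singlet pair operator annihilates a vector with no down electrons (each of its two terms
ends in a down annihilator, directly or after an up annihilator). -/
theorem localPair_mulVec_eq_zero_of_noDown (g : Site 2 → ℝ) (L : ℕ) [NeZero L] (x : TorusSite 2 L)
    {ψ : Fock (Orb (FermionTorus 2 L))} (h : NoDown ψ) : localPair g L x *ᵥ ψ = 0 := by
  have h1 : ∀ a b : FermionTorus 2 L, (annihilation (orb a 0) * annihilation (orb b 1)) *ᵥ ψ = 0 :=
    fun a b => by rw [← mulVec_mulVec, annihilation_down_mulVec_of_noDown h, mulVec_zero]
  have h2 : ∀ a b : FermionTorus 2 L, (annihilation (orb a 1) * annihilation (orb b 0)) *ᵥ ψ = 0 :=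
    fun a b => by
      rw [← mulVec_mulVec, annihilation_down_mulVec_of_noDown (noDown_annihilation_mulVec h _)]
  simp only [localPair, sum_mulVec, smul_mulVec, sub_mulVec, h1, h2, sub_zero, smul_zero,
    Finset.sum_const_zero]

/-- `2⌊r/2⌋ ≤ n` whenever `r ≤ n`. -/
theorem two_mul_natFloor_half_le {r : ℝ} {n : ℕ} (hr : r ≤ n) : 2 * ⌊r / 2⌋₊ ≤ n := by
  rcases le_or_gt 0 r with h0 | h0
  · have h1 : ((2 * ⌊r / 2⌋₊ : ℕ) : ℝ) ≤ n := by
      have := Nat.floor_le (by positivity : 0 ≤ r / 2)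
      push_cast
      linarith
    exact_mod_cast h1
  · rw [Nat.floor_of_nonpos (by linarith : r / 2 ≤ 0)]
    simp

/-- The summit's electron number fits into ONE spin species: `N_L = 2⌊(1-δ)L²/2⌋ ≤ L²` for `δ ≥ 0`. -/
theorem sectorNumber_le_sq {δ : ℝ} (hδ : 0 ≤ δ) (L : ℕ) : 2 * ⌊(1 - δ) * (L : ℝ) ^ 2 / 2⌋₊ ≤ L ^ 2 := by
  refine two_mul_natFloor_half_le ?_
  have hL : (0 : ℝ) ≤ (L : ℝ) ^ 2 := by positivity
  push_cast
  nlinarith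

/-- **The fully polarised sector** `(N, S^z = N/2)` of the pure Hubbard torus, `N ≤ L²`: a ground state exists and the
sector energy bounds `H` from below on the sector (Hermitian, block-diagonal in `(N↑, N↓)`; the `(N, 0)`-block is the
free spinless band — no double occupancy). -/
theorem top_sector_groundState (U : ℝ) (L N : ℕ) (hN : N ≤ L ^ 2) :
    (∃ v ∈ szSector N ((N : ℝ) / 2), v ≠ 0 ∧ hubbardTorus 2 L 1 U *ᵥ v =
        (((hubbardTorus 2 L 1 U).minEnergyOn (szSector N ((N : ℝ) / 2)) : ℝ) : ℂ) • v) ∧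
      ∀ v ∈ szSector N ((N : ℝ) / 2), star v ⬝ᵥ v = 1 →
        (hubbardTorus 2 L 1 U).minEnergyOn (szSector N ((N : ℝ) / 2)) ≤ (star v ⬝ᵥ hubbardTorus 2 L 1 U *ᵥ v).re := by
  classical
  have hcard : N ≤ Fintype.card (FermionTorus 2 L) := by
    simpa [FermionTorus, Fintype.card_fin] using hN
  obtain ⟨α₀, -, hα₀⟩ : ∃ α₀ : Finset (FermionTorus 2 L), α₀ ⊆ Finset.univ ∧ α₀.card = N :=
    Finset.exists_subset_card_eq (by rwa [Finset.card_univ])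
  have hp : ∃ s : Finset (Orb (FermionTorus 2 L)), (upPart s).card = N ∧ (downPart s).card = 0 :=
    ⟨pairSet α₀ ∅, by rw [upPart_pairSet, hα₀], by rw [downPart_pairSet, Finset.card_empty]⟩
  have hinv : ∀ s s' : Finset (Orb (FermionTorus 2 L)), ¬((upPart s).card = N ∧ (downPart s).card = 0) →
      ((upPart s').card = N ∧ (downPart s').card = 0) → hubbardTorus 2 L 1 U s s' = 0 := by
    intro s s' hs hs'
    by_contra hne
    have := LiebThm1.preservesSectors_hamiltonian (fermionTorusGraph 2 L) 1 U s s' hne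
    exact hs ⟨this.1.trans hs'.1, this.2.trans hs'.2⟩
  exact sector_groundState (hubbardTorus 2 L 1 U) (LiebThm1.hamiltonian_isHermitian (fermionTorusGraph 2 L) 1 U)
    (fun s => (upPart s).card = N ∧ (downPart s).card = 0) hp hinv (szSector N ((N : ℝ) / 2))
    (mem_szSector_top_iff N)

/-- **Normalised ground states exist in the fully polarised sector** `(N, S^z = N/2)`, `N ≤ L²`. -/
theorem exists_unit_isGroundStateInSector_top (U : ℝ) (L N : ℕ) (hN : N ≤ L ^ 2) :
    ∃ ψ : Fock (Orb (FermionTorus 2 L)), star ψ ⬝ᵥ ψ = 1 ∧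
      IsGroundStateInSector (hubbardTorus 2 L 1 U) N ((N : ℝ) / 2) ψ := by
  obtain ⟨⟨v, hv, hv0, hHv⟩, -⟩ := top_sector_groundState U L N hN
  obtain ⟨c, hc0, hc1⟩ := exists_smul_unit hv0
  exact ⟨c • v, hc1, isGroundStateInSector_smul ⟨hv, hv0, hHv⟩ hc0⟩

/-- The summit matrix with the `S^z` LABEL FREE: every normalised ground state of every sector `(N_L, M_L)`. -/
def MatrixAnySz (U δ : ℝ) : Prop :=
  ∀ (N : ℕ → ℕ) (M : ℕ → ℝ) (ψ : ∀ L, Fock (Orb (FermionTorus 2 L))),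
    (∀ L, Even L → N L = 2 * ⌊(1 - δ) * (L : ℝ) ^ 2 / 2⌋₊ ∧ star (ψ L) ⬝ᵥ ψ L = 1 ∧
        IsGroundStateInSector (hubbardTorus 2 L 1 U) (N L) (M L) (ψ L)) →
      HasLongRangeOrder (fun k => halfOpenBox 2 (2 * k))
        (fun k => torusPullback (pairFieldCorr dWaveFormFactor ψ) (2 * k))

/-- It is a strengthening of the matrix (`M ≡ 0`). -/
theorem matrix_of_matrixAnySz {U δ : ℝ} (h : MatrixAnySz U δ) : HasDWavePairFieldLROAt U δ :=
  fun N ψ hψ => h N (fun _ => 0) ψ hψ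

/-- **The `S^z = 0` label is load-bearing, unconditionally**: with the spin label free the matrix is FALSE at
every coupling and every `δ ≥ 0` — witness: normalised ground states of the FULLY POLARISED sectors
`(N_L, N_L/2)` (they exist, `N_L ≤ L²`), on which every local singlet pair operator vanishes, so the `d`-wave
pair correlations vanish identically along the whole sequence. -/
theorem not_matrixAnySz (U : ℝ) {δ : ℝ} (hδ : 0 ≤ δ) : ¬ MatrixAnySz U δ := by
  intro h
  have key : ∀ L : ℕ, ∃ φ : Fock (Orb (FermionTorus 2 L)), star φ ⬝ᵥ φ = 1 ∧
      IsGroundStateInSector (hubbardTorus 2 L 1 U) (2 * ⌊(1 - δ) * (L : ℝ) ^ 2 / 2⌋₊)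
        (((2 * ⌊(1 - δ) * (L : ℝ) ^ 2 / 2⌋₊ : ℕ) : ℝ) / 2) φ :=
    fun L => exists_unit_isGroundStateInSector_top U L _ (sectorNumber_le_sq hδ L)
  choose φ hφ using key
  have hl := h (fun L => 2 * ⌊(1 - δ) * (L : ℝ) ^ 2 / 2⌋₊)
    (fun L => ((2 * ⌊(1 - δ) * (L : ℝ) ^ 2 / 2⌋₊ : ℕ) : ℝ) / 2) φ fun L _ => ⟨rfl, (hφ L).1, (hφ L).2⟩
  have hzero : ∀ (L : ℕ) (x y : TorusSite 2 L), pairFieldCorr dWaveFormFactor φ L x y = 0 := by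
    intro L x y
    cases L with
    | zero => rfl
    | succ L =>
      rw [pairFieldCorr_succ, expect, ← mulVec_mulVec,
        localPair_mulVec_eq_zero_of_noDown _ _ _ (noDown_of_mem_szSector_top (hφ (L + 1)).2.1),
        mulVec_zero, dotProduct_zero, Complex.zero_re]
  unfold HasLongRangeOrder at hl
  simp only [torusPullback_apply, hzero, Finset.sum_const_zero, zero_div, liminf_const] at hl
  exact lt_irrefl _ hl

/-! ### §4e (gen 2) Junk in the other direction: odd particle numbers EMPTY the `S^z = 0` sector -/

section OddSector

variable {Λ : Type*} [LinearOrder Λ] [Fintype Λ]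

/-- `szSector N 0 = ⊥` for odd `N`: a vector of the `S^z = 0` sector with an odd particle number vanishes
(`N = N↑ + N↓ = 2N↑`). -/
theorem eq_zero_of_mem_szSector_zero_odd {N : ℕ} (hN : Odd N) {ψ : Fock (Orb Λ)} (h : ψ ∈ szSector N 0) :
    ψ = 0 := by
  rw [mem_szSector_iff] at h
  funext s
  by_cases hc : s.card = N
  · have h2 := congrFun h.2 s
    rw [LiebThm1.spinZ_mulVec_apply, Pi.smul_apply, smul_eq_mul, Complex.ofReal_zero, zero_mul] at h2
    rcases mul_eq_zero.1 h2 with h3 | h3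
    · rcases mul_eq_zero.1 h3 with h4 | h4
      · norm_num at h4
      · have h5 : (upPart s).card = (downPart s).card := by exact_mod_cast sub_eq_zero.1 h4
        exfalso
        refine Nat.not_even_iff_odd.2 hN ?_
        rw [← hc, card_eq_upPart_add_downPart, h5]
        exact ⟨_, rfl⟩
    · exact h3
  · exact h.1 s hc

/-- Hence no sector ground state exists at `(N, 0)` with `N` odd (the predicate asks `ψ ≠ 0`; the sector
energy `minEnergyOn _ ⊥ = sInf ∅ = 0` is the junk value the round-1 triage used against free-`N` stubs). -/
theorem not_isGroundStateInSector_zero_odd {N : ℕ} (hN : Odd N) (H : Matrix (Finset (Orb Λ)) (Finset (Orb Λ)) ℂ)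
    (ψ : Fock (Orb Λ)) : ¬ IsGroundStateInSector H N 0 ψ :=
  fun h => h.2.1 (eq_zero_of_mem_szSector_zero_odd hN h.1)

end OddSector

/-- The matrix with an ODD particle number `N_L = 2⌊(1-δ)L²/2⌋ + 1`. -/
def MatrixOddNumber (U δ : ℝ) : Prop :=
  ∀ (N : ℕ → ℕ) (ψ : ∀ L, Fock (Orb (FermionTorus 2 L))),
    (∀ L, Even L → N L = 2 * ⌊(1 - δ) * (L : ℝ) ^ 2 / 2⌋₊ + 1 ∧ star (ψ L) ⬝ᵥ ψ L = 1 ∧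
        IsGroundStateInSector (hubbardTorus 2 L 1 U) (N L) 0 (ψ L)) →
      HasLongRangeOrder (fun k => halfOpenBox 2 (2 * k))
        (fun k => torusPullback (pairFieldCorr dWaveFormFactor ψ) (2 * k))

/-- **With an odd particle number the matrix is TRIVIALLY TRUE** (empty hypothesis class at every even side,
already at `L = 0`): the parity built into `N_L = 2⌊(1-δ)L²/2⌋` is what keeps the summit matrix contentful, and
any stub typed with a free `N : ℕ` over `szSector N 0` inherits this vacuity at odd `N`. -/
theorem matrixOddNumber_trivial (U δ : ℝ) : MatrixOddNumber U δ := by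
  intro N ψ hψ
  exfalso
  obtain ⟨hN, -, hgs⟩ := hψ 0 (by decide)
  exact not_isGroundStateInSector_zero_odd ⟨_, hN⟩ _ _ hgs

/-! ### §8e (gen 2) The FERROMAGNETIC hazard: saturated ferromagnets are singlet-pair-free (tree, route NoGo) -/

/-- Saturated (Nagaoka) ferromagnetism of the summit's sector on the torus of side `L`: the `(N_L, S^z = 0)`
sector of the pure Hubbard model contains a ground state of maximal total spin `S = N_L/2`
(`S²ψ = n(n+1)ψ`, `n = N_L/2`; the `S^z = 0` member of the top multiplet). Equivalent to
`E_min(N_L, N_L/2) = E_min(N_L, 0)` by the `SU(2)` descent of the tree's `groundEnergyAt_eq_minEnergyOn_szSector`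
(not re-proved here). OPEN at positive hole density for every finite `U` (Tasaki, Prog. Theor. Phys. 99 (1998) 489, p. 21). -/
def SaturatedAt (U δ : ℝ) (L : ℕ) : Prop :=
  ∃ ψ : Fock (Orb (FermionTorus 2 L)),
    IsGroundStateInSector (hubbardTorus 2 L 1 U) (2 * ⌊(1 - δ) * (L : ℝ) ^ 2 / 2⌋₊) 0 ψ ∧
      spinSq *ᵥ ψ = (((⌊(1 - δ) * (L : ℝ) ^ 2 / 2⌋₊ : ℝ) * ((⌊(1 - δ) * (L : ℝ) ^ 2 / 2⌋₊ : ℝ) + 1) : ℝ) : ℂ) • ψ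

/-- **Saturated ferromagnetism on all large tori kills the summit matrix** at `(U, δ)` (any `U`, `δ ≥ -1`): the
singlet `d`-wave pair field annihilates every maximal-spin state (route NoGo, crux 5:
`Summit.HubbardSuperconductivity.NoGo.localPair_mulVec_eq_zero_of_saturated`, Tasaki 1998 p. 20), so along the
admissible sequence picking the ferromagnetic member wherever it exists the pair correlations vanish identically
from some side on. The witness phase is TRANSLATION-INVARIANT and unfrustrated on every torus (odd sides
included): the parity filter of §7/§8(iii) does not touch it. -/
theorem not_matrix_of_eventually_saturated {U δ : ℝ} (hδ : -1 ≤ δ) (hFM : ∀ᶠ L : ℕ in atTop, SaturatedAt U δ L) :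
    ¬ HasDWavePairFieldLROAt U δ := by
  intro h
  obtain ⟨L₀, hL₀⟩ := eventually_atTop.1 hFM
  choose ψ hψ using fun L => Summit.HubbardSuperconductivity.NoGo.exists_unit_groundStateInSector_saturated L U
    (Summit.HubbardSuperconductivity.NoGo.floor_pairNumber_le δ hδ L) (L₀ ≤ L) (fun hL => hL₀ L hL)
  have hl := h (fun L => 2 * ⌊(1 - δ) * (L : ℝ) ^ 2 / 2⌋₊) ψ fun L _ => ⟨rfl, (hψ L).1, (hψ L).2.1⟩
  have hzero : ∀ L : ℕ, L₀ ≤ L → ∀ x y : TorusSite 2 L, pairFieldCorr dWaveFormFactor ψ L x y = 0 := by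
    intro L hL x y
    cases L with
    | zero => rfl
    | succ L =>
      have hS := (hψ (L + 1)).2.2 hL
      have hS' : spinSq *ᵥ ψ (L + 1) =
          (((((2 * ⌊(1 - δ) * ((L + 1 : ℕ) : ℝ) ^ 2 / 2⌋₊ : ℕ) : ℝ) / 2) *
            ((((2 * ⌊(1 - δ) * ((L + 1 : ℕ) : ℝ) ^ 2 / 2⌋₊ : ℕ) : ℝ) / 2) + 1) : ℝ) : ℂ) • ψ (L + 1) := by
        rw [hS]; congr 2; push_cast; ring
      exact Summit.HubbardSuperconductivity.NoGo.pairFieldCorr_succ_eq_zero_of_saturated dWaveFormFactor ψ L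
        ((mem_szSector_iff _ _ _).1 (hψ (L + 1)).2.1.1).1 hS' x y
  unfold HasLongRangeOrder at hl
  have hev : ∀ᶠ k : ℕ in atTop,
      (∑ x ∈ halfOpenBox 2 (2 * k), ∑ y ∈ halfOpenBox 2 (2 * k),
          torusPullback (pairFieldCorr dWaveFormFactor ψ) (2 * k) x y) /
        ((halfOpenBox 2 (2 * k)).card : ℝ) ^ 2 = (fun _ : ℕ => (0 : ℝ)) k := by
    refine eventually_atTop.2 ⟨L₀, fun k hk => ?_⟩
    simp only [torusPullback_apply, hzero (2 * k) (by omega), Finset.sum_const_zero, zero_div]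
  rw [liminf_congr hev, liminf_const] at hl
  exact lt_irrefl _ hl

/-- **Infinitely many even tori suffice** (`δ ≥ 0`): by the UNIFORM-FLOOR normal form of the summit matrix (sibling
stmt-2009's landed `Summit.HubbardSuperconductivity.WcbcsSsbToTorusLRO.Negative.floor_of_hasDWavePairFieldLROAt`:
matrix ⇒ `∃ a > 0, ∀ᶠ k, ∀` normalised ground states `ψ` of side `2k+2`, `a(2k+2)⁴ ≤ Re⟨ψ, P†Pψ⟩`), a saturated member
on infinitely many even sides already contradicts the matrix (`Pψ = 0` there, route NoGo's
`pairField_mulVec_eq_zero_of_saturated`). -/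
theorem not_matrix_of_frequently_saturated {U δ : ℝ} (hδ : 0 ≤ δ)
    (hFM : ∃ᶠ k : ℕ in atTop, SaturatedAt U δ (2 * k + 1 + 1)) : ¬ HasDWavePairFieldLROAt U δ := by
  intro h
  obtain ⟨a, ha, hev⟩ :=
    Summit.HubbardSuperconductivity.WcbcsSsbToTorusLRO.Negative.floor_of_hasDWavePairFieldLROAt hδ h
  obtain ⟨k, hk, ψ, hgs, hS⟩ := (hev.and_frequently hFM).exists
  obtain ⟨c, hc0, hc1⟩ := exists_smul_unit hgs.2.1
  have hle := hk (c • ψ) (isGroundStateInSector_smul hgs hc0) hc1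
  have hN : IsNParticle (2 * ⌊(1 - δ) * ((2 * k + 1 + 1 : ℕ) : ℝ) ^ 2 / 2⌋₊) ψ :=
    ((mem_szSector_iff _ _ _).1 hgs.1).1
  have hS' : spinSq *ᵥ ψ =
      (((((2 * ⌊(1 - δ) * ((2 * k + 1 + 1 : ℕ) : ℝ) ^ 2 / 2⌋₊ : ℕ) : ℝ) / 2) *
        ((((2 * ⌊(1 - δ) * ((2 * k + 1 + 1 : ℕ) : ℝ) ^ 2 / 2⌋₊ : ℕ) : ℝ) / 2) + 1) : ℝ) : ℂ) • ψ := by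
    rw [hS]; congr 2; push_cast; ring
  have hP : pairField dWaveFormFactor (2 * k + 1 + 1) *ᵥ (c • ψ) = 0 := by
    rw [mulVec_smul, Summit.HubbardSuperconductivity.NoGo.pairField_mulVec_eq_zero_of_saturated
      dWaveFormFactor (2 * k + 1 + 1) hN hS', smul_zero]
  rw [expect, ← mulVec_mulVec, hP, mulVec_zero, dotProduct_zero, Complex.zero_re] at hle
  have hpos : 0 < a * ((2 * k + 1 + 1 : ℕ) : ℝ) ^ 4 := by positivity
  linarith

/-- Reading for THIS crux: in a saturated-ferromagnetic corner the crux ASSERTS the absence of density-matched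
Koma–Tasaki `d`-wave order at that coupling (physically right — a saturated ferromagnet has no singlet order, so
the body is vacuous there; the hazard is the first-order FM/`d`-SC boundary in `μ`, see the docblock §8(v)). -/
theorem crux_imp_noOrder_of_eventually_saturated (hc : SsbToEvenTorusLro) {U δ : ℝ} (hU : 0 < U)
    (hδ : δ ∈ Ioo (0:ℝ) 1) (hFM : ∀ᶠ L : ℕ in atTop, SaturatedAt U δ L) (μ : ℝ)
    (hd : Tendsto (fun L : ℕ => ((hubbardTorusWith 2 (L + 1) 1 U μ).groundStateFunctional totalNumber).re /
      ((L + 1 : ℕ) : ℝ) ^ 2) atTop (𝓝 (1 - δ))) : ¬ HasDWaveOrder U μ :=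
  fun ho => not_matrix_of_eventually_saturated (by linarith [hδ.1]) hFM (hc U δ μ hU hδ hd ho)


/-! ### §8f (gen 2) ENERGY FORM of saturation: `(S⁻)ⁿ`-descent from the fully polarised sector -/

section Descent

variable {Λ : Type*} [LinearOrder Λ] [Fintype Λ]

/-- `(S⁻)ʲ` maps a nonzero vector of the fully polarised sector `(2n, 0)` (`2n` up, no down electrons) to a
NONZERO vector of the sector `(2n - j, j)`, `j ≤ n` (`S⁻` is injective while `N↓ < N↑`, tree
`LiebThm1.eq_zero_of_spinMinus_mulVec_eq_zero`). -/
theorem isInSector_spinMinus_pow_mulVec {n : ℕ} {φ : Fock (Orb Λ)} (hφ : IsInSector (2 * n) 0 φ) (hφ0 : φ ≠ 0) :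
    ∀ j : ℕ, j ≤ n →
      IsInSector (2 * n - j) j (Literature.MathematicalPhysics.QuantumLattice.spinMinus ^ j *ᵥ φ) ∧
        Literature.MathematicalPhysics.QuantumLattice.spinMinus ^ j *ᵥ φ ≠ 0 := by
  intro j
  induction j with
  | zero =>
    intro _
    simpa using And.intro hφ hφ0
  | succ j ih =>
    intro hj
    obtain ⟨hs, hne⟩ := ih (by omega)
    have e : 2 * n - j = (2 * n - (j + 1)) + 1 := by omega
    rw [e] at hs
    refine ⟨?_, ?_⟩
    · rw [pow_succ', ← mulVec_mulVec]
      exact LiebThm1.lowersSpin_spinMinus.isInSector_mulVec hs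
    · rw [pow_succ', ← mulVec_mulVec]
      exact fun h0 => hne (LiebThm1.eq_zero_of_spinMinus_mulVec_eq_zero (by omega) hs h0)

/-- A vector of the fully polarised sector `(2n, 0)` has maximal total spin: `S²φ = n(n+1)φ`
(`S⁺φ = 0`, `S^zφ = nφ`, `S⁻S⁺ = S² - (S^z)² - S^z`). -/
theorem spinSq_mulVec_of_isInSector_top {n : ℕ} {φ : Fock (Orb Λ)} (hφ : IsInSector (2 * n) 0 φ) :
    spinSq *ᵥ φ = (((n : ℝ) * ((n : ℝ) + 1) : ℝ) : ℂ) • φ := by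
  have hP : spinPlus *ᵥ φ = 0 := LiebThm1.raisesSpin_spinPlus.mulVec_eq_zero hφ
  have hZ := LiebThm1.spinZ_mulVec_of_isInSector hφ
  have h : (Literature.MathematicalPhysics.QuantumLattice.spinMinus * spinPlus : Matrix (Finset (Orb Λ)) _ ℂ) *ᵥ φ =
      (spinSq - HubbardWave0.spinZ * HubbardWave0.spinZ - HubbardWave0.spinZ) *ᵥ φ := by
    rw [Summit.HubbardSuperconductivity.NoGo.spinMinus_mul_spinPlus_eq]
  rw [← mulVec_mulVec, hP, mulVec_zero, sub_mulVec, sub_mulVec, ← mulVec_mulVec, hZ, mulVec_smul, hZ,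
    smul_smul, sub_sub, eq_comm, sub_eq_zero, ← add_smul] at h
  rw [h]
  congr 1
  push_cast
  ring

/-- **`SU(2)` descent, packaged**: from a nonzero `H`-eigenvector of the fully polarised sector `(2n, 0)` to a nonzero
`H`-eigenvector of the `S^z = 0` sector `(n, n)` with the SAME eigenvalue and maximal total spin `S² = n(n+1)`,
for any `H` commuting with `S⁻`. -/
theorem saturated_descendant (H : Matrix (Finset (Orb Λ)) (Finset (Orb Λ)) ℂ)
    (hH : Commute H Literature.MathematicalPhysics.QuantumLattice.spinMinus) {n : ℕ} {φ : Fock (Orb Λ)}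
    (hφ : IsInSector (2 * n) 0 φ) (hφ0 : φ ≠ 0) {E : ℂ} (hE : H *ᵥ φ = E • φ) :
    ∃ w : Fock (Orb Λ), IsInSector n n w ∧ w ≠ 0 ∧ H *ᵥ w = E • w ∧
      spinSq *ᵥ w = (((n : ℝ) * ((n : ℝ) + 1) : ℝ) : ℂ) • w := by
  obtain ⟨hw, hw0⟩ := isInSector_spinMinus_pow_mulVec hφ hφ0 n le_rfl
  have hnn : 2 * n - n = n := by omega
  rw [hnn] at hw
  refine ⟨_, hw, hw0, ?_, ?_⟩
  · rw [mulVec_mulVec, (hH.pow_right n).eq, ← mulVec_mulVec, hE, mulVec_smul]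
  · have hSS : (spinSq : Matrix (Finset (Orb Λ)) _ ℂ) * Literature.MathematicalPhysics.QuantumLattice.spinMinus ^ n =
        Literature.MathematicalPhysics.QuantumLattice.spinMinus ^ n * spinSq := by
      rw [← LiebTwo.su2Casimir_spin_eq_spinSq]
      exact LiebTwo.isSu2Triple_spin.su2Casimir_mul_M_pow n
    rw [mulVec_mulVec, hSS, ← mulVec_mulVec, spinSq_mulVec_of_isInSector_top hφ, mulVec_smul]

/-- **`SU(2)` ascent, packaged**: from a nonzero `H`-eigenvector of the `S^z = 0` sector `(n, n)` with MAXIMAL total spin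
`S² = n(n+1)` to a nonzero `H`-eigenvector of the fully polarised sector `(2n, 0)` with the same eigenvalue, for any
`H` commuting with `S⁺` (`(S⁺)ʲ` does not kill it: `‖S⁺u‖² = (n(n+1) - j(j+1))‖u‖²` on the sector `(n+j, n-j)`, route
NoGo's `star_spinPlus_mulVec_dotProduct`). -/
theorem saturated_ascent (H : Matrix (Finset (Orb Λ)) (Finset (Orb Λ)) ℂ) (hH : Commute H spinPlus) {n : ℕ}
    {ψ : Fock (Orb Λ)} (hψ : IsInSector n n ψ) (hψ0 : ψ ≠ 0) {E : ℂ} (hE : H *ᵥ ψ = E • ψ)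
    (hS : spinSq *ᵥ ψ = (((n : ℝ) * ((n : ℝ) + 1) : ℝ) : ℂ) • ψ) :
    ∃ u : Fock (Orb Λ), IsInSector (2 * n) 0 u ∧ u ≠ 0 ∧ H *ᵥ u = E • u := by
  have key : ∀ j : ℕ, j ≤ n → IsInSector (n + j) (n - j) (spinPlus ^ j *ᵥ ψ) ∧ spinPlus ^ j *ᵥ ψ ≠ 0 ∧
      spinSq *ᵥ (spinPlus ^ j *ᵥ ψ) = (((n : ℝ) * ((n : ℝ) + 1) : ℝ) : ℂ) • (spinPlus ^ j *ᵥ ψ) := by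
    intro j
    induction j with
    | zero =>
      intro _
      simpa using And.intro hψ (And.intro hψ0 hS)
    | succ j ih =>
      intro hj
      obtain ⟨hs, hne, hSj⟩ := ih (by omega)
      have hSsucc : spinSq *ᵥ (spinPlus ^ (j + 1) *ᵥ ψ) =
          (((n : ℝ) * ((n : ℝ) + 1) : ℝ) : ℂ) • (spinPlus ^ (j + 1) *ᵥ ψ) := by
        have hc : (spinSq * spinPlus : Matrix (Finset (Orb Λ)) _ ℂ) = spinPlus * spinSq := by
          rw [← LiebTwo.su2Casimir_spin_eq_spinSq]; exact LiebTwo.isSu2Triple_spin.su2Casimir_mul_P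
        rw [pow_succ', ← mulVec_mulVec, mulVec_mulVec, hc, ← mulVec_mulVec, hSj, mulVec_smul]
      have hne' : spinPlus ^ (j + 1) *ᵥ ψ ≠ 0 := by
        rw [pow_succ', ← mulVec_mulVec]
        intro h0
        have hnorm : star (spinPlus *ᵥ (spinPlus ^ j *ᵥ ψ)) ⬝ᵥ (spinPlus *ᵥ (spinPlus ^ j *ᵥ ψ)) =
            ((((n : ℝ) * ((n : ℝ) + 1) - (j : ℝ) * j - j : ℝ)) : ℂ) *
              (star (spinPlus ^ j *ᵥ ψ) ⬝ᵥ (spinPlus ^ j *ᵥ ψ)) := by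
          rw [Summit.HubbardSuperconductivity.NoGo.star_spinPlus_mulVec_dotProduct hs hSj]
          congr 1
          rw [Nat.cast_sub (show j ≤ n by omega)]
          push_cast
          ring
        rw [h0, dotProduct_zero] at hnorm
        have hpos : (0 : ℝ) < (n : ℝ) * ((n : ℝ) + 1) - (j : ℝ) * j - j := by
          have hj' : (j : ℝ) + 1 ≤ n := by exact_mod_cast hj
          have hj0 : (0 : ℝ) ≤ j := Nat.cast_nonneg j
          nlinarith
        have h0' : star (spinPlus ^ j *ᵥ ψ) ⬝ᵥ (spinPlus ^ j *ᵥ ψ) = 0 :=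
          (mul_eq_zero.1 hnorm.symm).resolve_left (by exact_mod_cast hpos.ne')
        exact hne (dotProduct_star_self_eq_zero.1 h0')
      have e : n - j = (n - (j + 1)) + 1 := by omega
      rw [e] at hs
      refine ⟨?_, hne', hSsucc⟩
      rw [show n + (j + 1) = (n + j) + 1 by ring, pow_succ', ← mulVec_mulVec]
      exact LiebThm1.raisesSpin_spinPlus.isInSector_mulVec hs
  obtain ⟨hs, hne, -⟩ := key n le_rfl
  rw [show n + n = 2 * n by ring, Nat.sub_self] at hs
  refine ⟨_, hs, hne, ?_⟩
  rw [mulVec_mulVec, (hH.pow_right n).eq, ← mulVec_mulVec, hE, mulVec_smul]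

end Descent

/-- **ENERGY FORM ⇒ saturation.** If the fully polarised sector `(2n, S^z = n)` of the pure Hubbard torus attains
the `(2n, S^z = 0)` sector energy, then the `S^z = 0` sector contains a SATURATED ground state — the
`(S⁻)ⁿ`-descendant of a top-sector ground state (same energy: `[H, S⁻] = 0`; same `S² = n(n+1)`: `[S², S⁻] = 0`;
nonzero by injectivity of the descent). This is the form in which Nagaoka-stability numerics and variational
(in)stability bounds are phrased (`E_FM` versus the best competitor). -/
theorem saturatedGS_of_energy_eq (U : ℝ) (L n : ℕ) (hn : 2 * n ≤ L ^ 2)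
    (hE : (hubbardTorus 2 L 1 U).minEnergyOn (szSector (2 * n) (((2 * n : ℕ) : ℝ) / 2)) =
      (hubbardTorus 2 L 1 U).minEnergyOn (szSector (2 * n) 0)) :
    ∃ ψ : Fock (Orb (FermionTorus 2 L)), IsGroundStateInSector (hubbardTorus 2 L 1 U) (2 * n) 0 ψ ∧
      spinSq *ᵥ ψ = (((n : ℝ) * ((n : ℝ) + 1) : ℝ) : ℂ) • ψ := by
  obtain ⟨φ, -, hφ⟩ := exists_unit_isGroundStateInSector_top U L (2 * n) hn
  have hsec : IsInSector (2 * n) 0 φ := (mem_szSector_top_iff _ _).1 hφ.1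
  have hc : Commute (hubbardTorus 2 L 1 U) Literature.MathematicalPhysics.QuantumLattice.spinMinus :=
    LiebThm1.hamiltonian_commute_spinMinus (fermionTorusGraph 2 L) 1 U
  obtain ⟨w, hw, hw0, hHw, hSw⟩ := saturated_descendant (hubbardTorus 2 L 1 U) hc hsec hφ.2.1 hφ.2.2
  refine ⟨w, ⟨(mem_szSector_two_mul_zero_iff n w).2 hw, hw0, ?_⟩, hSw⟩
  rw [← hE]
  exact hHw

/-- Hence the energy condition on all large tori (resp. infinitely many even tori) kills the summit matrix at
`(U, δ)`, by §8e. -/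
theorem saturatedAt_of_energy_eq {U δ : ℝ} (hδ : 0 ≤ δ) {L : ℕ}
    (hE : (hubbardTorus 2 L 1 U).minEnergyOn
        (szSector (2 * ⌊(1 - δ) * (L : ℝ) ^ 2 / 2⌋₊) (((2 * ⌊(1 - δ) * (L : ℝ) ^ 2 / 2⌋₊ : ℕ) : ℝ) / 2)) =
      (hubbardTorus 2 L 1 U).minEnergyOn (szSector (2 * ⌊(1 - δ) * (L : ℝ) ^ 2 / 2⌋₊) 0)) :
    SaturatedAt U δ L :=
  saturatedGS_of_energy_eq U L _ (sectorNumber_le_sq hδ L) hE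


/-- `E_min(2n, 0) ≤ E_min(2n, n)` ALWAYS: every top-sector energy occurs in the `S^z = 0` sector (descent + the
variational principle on the `(n, n)` sector, tree `szSector_groundState`). -/
theorem minEnergyOn_zero_le_top (U : ℝ) (L n : ℕ) (hn : 2 * n ≤ L ^ 2) :
    (hubbardTorus 2 L 1 U).minEnergyOn (szSector (2 * n) 0) ≤
      (hubbardTorus 2 L 1 U).minEnergyOn (szSector (2 * n) (((2 * n : ℕ) : ℝ) / 2)) := by
  obtain ⟨φ, -, hφ⟩ := exists_unit_isGroundStateInSector_top U L (2 * n) hn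
  have hsec : IsInSector (2 * n) 0 φ := (mem_szSector_top_iff _ _).1 hφ.1
  have hc : Commute (hubbardTorus 2 L 1 U) Literature.MathematicalPhysics.QuantumLattice.spinMinus :=
    LiebThm1.hamiltonian_commute_spinMinus (fermionTorusGraph 2 L) 1 U
  obtain ⟨w, hw, hw0, hHw, -⟩ := saturated_descendant (hubbardTorus 2 L 1 U) hc hsec hφ.2.1 hφ.2.2
  have hcard : n ≤ Fintype.card (FermionTorus 2 L) := by
    have : n ≤ L ^ 2 := by omega
    simpa [FermionTorus, Fintype.card_fin] using this
  have hb : (hubbardTorus 2 L 1 U).minEnergyOn (szSector (2 * n) 0) * (star w ⬝ᵥ w).re ≤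
      (expect (hubbardTorus 2 L 1 U) w).re :=
    (szSector_groundState (fermionTorusGraph 2 L) 1 U hcard).2 w hw
  rw [expect, hHw, dotProduct_smul, smul_eq_mul, Complex.re_ofReal_mul] at hb
  have hpos : 0 < (star w ⬝ᵥ w).re := (Complex.pos_iff.1 (dotProduct_star_self_pos_iff.2 hw0)).1
  exact le_of_mul_le_mul_right hb hpos

/-- **Saturation ⇒ ENERGY FORM**: a saturated ground state in the `S^z = 0` sector raises (`(S⁺)ⁿ`) to a top-sector
eigenvector with the `(2n, 0)` energy, so `E_min(2n, n) ≤ E_min(2n, 0)`. -/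
theorem minEnergyOn_top_le_zero_of_saturated (U : ℝ) (L n : ℕ) (hn : 2 * n ≤ L ^ 2)
    (h : ∃ ψ : Fock (Orb (FermionTorus 2 L)), IsGroundStateInSector (hubbardTorus 2 L 1 U) (2 * n) 0 ψ ∧
      spinSq *ᵥ ψ = (((n : ℝ) * ((n : ℝ) + 1) : ℝ) : ℂ) • ψ) :
    (hubbardTorus 2 L 1 U).minEnergyOn (szSector (2 * n) (((2 * n : ℕ) : ℝ) / 2)) ≤
      (hubbardTorus 2 L 1 U).minEnergyOn (szSector (2 * n) 0) := by
  obtain ⟨ψ, hgs, hS⟩ := h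
  have hsec : IsInSector n n ψ := (mem_szSector_two_mul_zero_iff n ψ).1 hgs.1
  have hc : Commute (hubbardTorus 2 L 1 U) spinPlus := LiebThm1.hamiltonian_commute_spinPlus (fermionTorusGraph 2 L) 1 U
  obtain ⟨u, hu, hu0, hHu⟩ := saturated_ascent (hubbardTorus 2 L 1 U) hc hsec hgs.2.1 hgs.2.2 hS
  obtain ⟨c, hc0, hc1⟩ := exists_smul_unit hu0
  have hmem : c • u ∈ szSector (2 * n) (((2 * n : ℕ) : ℝ) / 2) :=
    Submodule.smul_mem _ c ((mem_szSector_top_iff _ _).2 hu)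
  have hb := (top_sector_groundState U L (2 * n) hn).2 (c • u) hmem hc1
  have hHcu : hubbardTorus 2 L 1 U *ᵥ (c • u) =
      (((hubbardTorus 2 L 1 U).minEnergyOn (szSector (2 * n) 0) : ℝ) : ℂ) • (c • u) := by
    rw [mulVec_smul, hHu, smul_comm]
  rw [hHcu, dotProduct_smul, hc1, smul_eq_mul, mul_one, Complex.ofReal_re] at hb
  exact hb

/-- **`SaturatedAt U δ L ↔ E_min(N_L, N_L/2) = E_min(N_L, 0)`** (`δ ≥ 0`): saturated ferromagnetism of the summit's
sector IS the statement that the fully polarised sector — a FREE SPINLESS band, energy `= Σ` of the `N_L` lowest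
`ε(k)` — attains the sector ground energy. Any upper bound on `E_min(N_L, 0)` below the polarised free energy
(e.g. the Hartree bound from the unpolarised free Slater determinant, `E_kin,unpol + U N_L²/(4L²)`) therefore
EXCLUDES the ferromagnetic hazard; see the docblock §8(v) for the numbers on the route's box. -/
theorem saturatedAt_iff_energy_eq {U δ : ℝ} (hδ : 0 ≤ δ) (L : ℕ) :
    SaturatedAt U δ L ↔
      (hubbardTorus 2 L 1 U).minEnergyOn
          (szSector (2 * ⌊(1 - δ) * (L : ℝ) ^ 2 / 2⌋₊) (((2 * ⌊(1 - δ) * (L : ℝ) ^ 2 / 2⌋₊ : ℕ) : ℝ) / 2)) =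
        (hubbardTorus 2 L 1 U).minEnergyOn (szSector (2 * ⌊(1 - δ) * (L : ℝ) ^ 2 / 2⌋₊) 0) :=
  ⟨fun h => le_antisymm (minEnergyOn_top_le_zero_of_saturated U L _ (sectorNumber_le_sq hδ L) h)
      (minEnergyOn_zero_le_top U L _ (sectorNumber_le_sq hδ L)),
    saturatedAt_of_energy_eq hδ⟩


end Summit.HubbardSuperconductivity.HubbardSuperconductivity.Cruxes.SsbToEvenTorusLro.Disproof
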